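import Literature.Geometry.Symplectic.LegendrianDarbouxChart
import Literature.Geometry.Symplectic.LegendrianStabilisationFraming
import Literature.Geometry.Symplectic.AttachingFramingProofs
import HarnessLib

/-!
# Legendrian stabilisation in the boundary of a Stein domain: the stabilised knot, the isotopy and the transported framing

Topic `Literature/Geometry/Symplectic`; third brick of the inline proof of the named fact
`Gompf1998_addLeftTwists` (`LegendrianRealisation.lean`; Gompf, *Handlebody construction of Stein
surfaces*, Ann. of Math. 148 (1998), §1, p. 622: *"we can add any number of left (negative)
twists to a Legendrian link in a `C⁰`-small manner … simply add a spiral"*), after the model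
(`LegendrianStabilisationModel.lean`, `LegendrianStabilisationFraming.lean`), the Darboux box
(`LegendrianDarbouxBox.lean`) and its instantiation from a Stein domain
(`LegendrianDarbouxChart.lean`).  Everything is proved; there are no named facts.

## Part 1. Chart-`p` calculus (`namespace LegendrianArc`)

Every tangent vector along the window is produced from chart-`p` coordinates by the derivative
`M y` of the inverse extended chart at the base point `p` (`LegendrianArc.M`); the tangent
coordinate changes invert it (`tangentCoordChange_M`, `M_tangentCoordChange`); `M y` identifies
the hyperplane `{X̂₀ = 0}` with `T∂W` (`M_apply_zero_iff`: `φ ∘ chart⁻¹` is constant on the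
hyperplane, uniqueness of derivatives on its tangent cone, `dφ ≠ 0`); the velocity of a smooth
loop reads as an ordinary derivative (`knotVelocity_eq_M`); the contact and Kähler forms read as
the chart representative and its exterior derivative (`contactForm_M`, `kahlerForm_M`).  On the
**box frame** `bv w ξ = M (emb (Ψ w)) (L3 (DΨ_w ξ))` this gives the formulas of the Darboux box
(`contactForm_bv`, `kahlerForm_bv`), tangency to `∂W`, injectivity, transversality transfer.

## Part 2. The stabilised knot and the isotopy (`structure StabData`, `namespace StabData`)

`StabData` = a Legendrian arc with a scale `ε`, a window `w₀`, a box `ℓ` and the separation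
property.  The signed distance `sdist` to the base parameter; the transported model curves `Wpt`;
the `1`-periodic family `G τ` (model curve of `LegendrianStabilisationModel` on the window, the
knot elsewhere; the branches agree where `4ε ≤ |sdist| < w₀`); the stages `knot τ : S¹ → W`, joint
smoothness, values in `∂W`, injectivity, the immersion property (through
`BoundaryChartImmersion.lean` on the window), smooth embeddings, **the stabilising isotopy**
`StabData.isotopy`; and **the stabilised knot is Legendrian** (`isLegendrianKnot_knot_one`: on the
window `α(ċ) = g (z' - y x') = 0`).

## Part 3. Transport of a framing along the isotopy

Given a framing `ν` of `K` (`IsKnotFraming`): its **box coordinates along the window**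
(`nraw`, `nbox`; `ν = bv (t • e₀) (n t)` with `n = DΨ⁻¹ (proj3 ν̂)`, `ν̂` the chart-`p` reading,
continuous by the trivialization of `TW` at `p`), transverse to the axis; **phases in box
coordinates** during the first half of the time interval (the knot fixed): `n₁` reparametrises `n`
to a constant near the base point, `n₂` moves the constant to `e₂` along `exp ((1 - s) log ζ₀)`,
`n₃` rotates `e₂` into the model framing `fr (t/ε)` (`frh`); during the second half the box
coordinates are kept (transverse to all model stages, `fr_ne_smul_dscurve`) while the base point
moves.  The family `νfam` (`FF` on `ℝ`: box frame on the window, `ν` elsewhere), its joint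
continuity into `TW` (`continuousAt_boxFrame`, periodic lift through `angA`/`angB`), the framing
property of every stage, and `isFramingAlong_νfam : IsFramingAlong X.isotopy₂ ν (X.νfam ν)` for the
time-doubled isotopy `isotopy₂` (`toFun r = knot (2r - 1)`).

## References

* R. E. Gompf, *Handlebody construction of Stein surfaces*, Ann. of Math. 148 (1998), §1. [Gompf1998]
* H. Geiges, *An Introduction to Contact Topology* (2008), §2.5, §3 (Darboux charts, Legendrian
  knots and their stabilisation). [folklore background]
-/

noncomputable section

open scoped Manifold ContDiff Topology
open Set Function Metric
open Literature.Geometry.Kaehler Literature.Topology.FourManifolds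

namespace Literature.Geometry.Symplectic

/-- `ℝ⁴`, the model of the tangent spaces. -/
local notation "E4" => EuclideanSpace ℝ (Fin 4)
/-- `ℝ³`. -/
local notation "E3" => EuclideanSpace ℝ (Fin 3)
/-- The unit sphere `𝕊ⁿ`. -/
local notation "𝕊 " n:arg => (Metric.sphere (0 : EuclideanSpace ℝ (Fin (n + 1))) 1)

namespace LegendrianDarboux

variable {W : Type*} [TopologicalSpace W] [ChartedSpace (EuclideanHalfSpace 4) W]
  [IsManifold (𝓡∂ 4) ∞ W] [CompactSpace W]

/-! ## Chart-`p` calculus: tangent vectors through the chart at the base point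

All tangent vectors along the window are produced by the derivative `M y` of the inverse chart
at `p`; the contact form, the Kähler form, tangency to the boundary and continuity into `TW`
are then read in the single chart at `p`. -/

namespace LegendrianArc

variable {S : SteinStructure W} (A : LegendrianArc S)

/-- The point of `W` with chart-`p` coordinates `y`. [folklore] -/
def pt (y : E4) : W := A.chart.symm y

/-- **`M y`**: the derivative within the half-space of the inverse extended chart at `p`, at the
point `y` of its target; it produces tangent vectors at `pt y` from chart-`p` coordinates.
[folklore] -/
def M (y : E4) : E4 →L[ℝ] E4 :=
  mfderivWithin 𝓘(ℝ, E4) (𝓡∂ 4) A.chart.symm (range (𝓡∂ 4)) y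

/-- `pt y` lies in the chart domain of `p`. [folklore] -/
theorem pt_mem_source {y : E4} (hy : y ∈ A.chart.target) :
    A.pt y ∈ (chartAt (EuclideanHalfSpace 4) A.p).source := by
  rw [← extChartAt_source (I := 𝓡∂ 4)]; exact A.chart.map_target hy

/-- `pt y` lies in the extended chart domain of `p`. [folklore] -/
theorem pt_mem_extSource {y : E4} (hy : y ∈ A.chart.target) :
    A.pt y ∈ (extChartAt (𝓡∂ 4) A.p).source :=
  A.chart.map_target hy

/-- `chart (pt y) = y`. [folklore] -/
theorem chart_pt {y : E4} (hy : y ∈ A.chart.target) : A.chart (A.pt y) = y := A.chart.right_inv hy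

/-- `M y` is the tangent coordinate change from the chart at `p` to the chart at `pt y`.
[folklore] -/
theorem M_eq_tangentCoordChange {y : E4} (hy : y ∈ A.chart.target) :
    A.M y = tangentCoordChange (𝓡∂ 4) A.p (A.pt y) (A.pt y) :=
  mfderivWithin_extChartAt_symm_eq_tangentCoordChange hy

/-- **(I1)** Reading `M y X̂` back in the chart at `p` returns `X̂`. [folklore] -/
theorem tangentCoordChange_M {y : E4} (hy : y ∈ A.chart.target) (X : E4) :
    tangentCoordChange (𝓡∂ 4) (A.pt y) A.p (A.pt y) (A.M y X) = X := by
  rw [A.M_eq_tangentCoordChange hy]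
  have hmem : A.pt y ∈ (extChartAt (𝓡∂ 4) A.p).source ∩ (extChartAt (𝓡∂ 4) (A.pt y)).source ∩
      (extChartAt (𝓡∂ 4) A.p).source :=
    ⟨⟨A.pt_mem_extSource hy, mem_extChartAt_source _⟩, A.pt_mem_extSource hy⟩
  rw [tangentCoordChange_comp hmem, tangentCoordChange_self (A.pt_mem_extSource hy)]

/-- **(I2)** `M y` applied to the chart-`p` reading of a tangent vector at `pt y` returns the
vector. [folklore] -/
theorem M_tangentCoordChange {y : E4} (hy : y ∈ A.chart.target) (X : E4) :
    A.M y (tangentCoordChange (𝓡∂ 4) (A.pt y) A.p (A.pt y) X) = X := by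
  rw [A.M_eq_tangentCoordChange hy]
  have hmem : A.pt y ∈ (extChartAt (𝓡∂ 4) (A.pt y)).source ∩ (extChartAt (𝓡∂ 4) A.p).source ∩
      (extChartAt (𝓡∂ 4) (A.pt y)).source :=
    ⟨⟨mem_extChartAt_source _, A.pt_mem_extSource hy⟩, mem_extChartAt_source _⟩
  rw [tangentCoordChange_comp hmem, tangentCoordChange_self (mem_extChartAt_source _)]

/-- `M y` is injective. [folklore] -/
theorem M_injective {y : E4} (hy : y ∈ A.chart.target) : Injective (A.M y) := fun X₁ X₂ h => by
  have := congrArg (tangentCoordChange (𝓡∂ 4) (A.pt y) A.p (A.pt y)) h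
  rwa [A.tangentCoordChange_M hy, A.tangentCoordChange_M hy] at this

/-- A point with vanishing `0`-th chart-`p` coordinate is a boundary point. [folklore] -/
theorem isBoundaryPoint_pt {y : E4} (hy : y ∈ A.chart.target) (hy0 : y 0 = 0) :
    (𝓡∂ 4).IsBoundaryPoint (A.pt y) :=
  (isBoundaryPoint_iff_apply_zero (A.pt_mem_source hy)).2 (by rw [← chart]; rw [A.chart_pt hy]; exact hy0)

/-- `φ` is at its maximum at the points of the hyperplane. [folklore] -/
theorem φ_pt_eq {q : E4} (hq : q ∈ A.chart.target) (hq0 : q 0 = 0) :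
    S.φ (A.pt q) = sSup (range S.φ) :=
  (S.boundary_eq _).1 (A.isBoundaryPoint_pt hq hq0)

/-- **(Hyp) `M y` identifies the hyperplane `{X̂₀ = 0}` with the tangent space of the boundary**:
for a point `y` of the hyperplane, `(M y X̂) ∈ T∂W ⇔ X̂ 0 = 0`.  (`⇐`: `φ ∘ chart.symm` is constant
on the hyperplane, so its derivative within the half-space kills the hyperplane directions —
uniqueness of derivatives on the tangent cone; `⇒`: that derivative is `dφ ∘ M y ≠ 0`, whose
kernel is then exactly the hyperplane.) [folklore] -/
theorem M_apply_zero_iff {y : E4} (hy : y ∈ A.chart.target) (hy0 : y 0 = 0) (X : E4) :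
    (A.M y X) 0 = 0 ↔ X 0 = 0 := by
  have hz : (𝓡∂ 4).IsBoundaryPoint (A.pt y) := A.isBoundaryPoint_pt hy hy0
  rw [← S.mfderiv_φ_apply_eq_zero_iff hz]
  set L : E4 →L[ℝ] ℝ := (S.dφ (A.pt y) : E4 →L[ℝ] ℝ).comp (A.M y) with hL
  -- `L` is the derivative of `φ ∘ chart.symm` within the half-space at `y`
  have hφd : HasMFDerivAt (𝓡∂ 4) 𝓘(ℝ, ℝ) S.φ (A.pt y) (S.dφ (A.pt y)) :=
    (S.φ_smooth.mdifferentiableAt (by simp)).hasMFDerivAt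
  have hsymm : HasMFDerivWithinAt 𝓘(ℝ, E4) (𝓡∂ 4) A.chart.symm (range (𝓡∂ 4)) y (A.M y) :=
    (mdifferentiableWithinAt_extChartAt_symm hy).hasMFDerivWithinAt
  have hcomp := hφd.comp_hasMFDerivWithinAt y hsymm
  have hF : HasFDerivWithinAt (S.φ ∘ A.chart.symm) L (range (𝓡∂ 4)) y :=
    hasMFDerivWithinAt_iff_hasFDerivWithinAt.1 hcomp
  -- restrict to the hyperplane, where `φ ∘ chart.symm` is constant near `y`
  set H : Set E4 := {q | q 0 = 0} with hH
  have hHsub : H ⊆ range (𝓡∂ 4) := fun q hq => by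
    rw [range_modelWithCornersEuclideanHalfSpace]; exact le_of_eq (Eq.symm hq)
  have hconst : ∀ᶠ q in 𝓝[H] y, (S.φ ∘ A.chart.symm) q = sSup (range S.φ) := by
    have h1 : ∀ᶠ q in 𝓝[H] y, q ∈ A.chart.target :=
      nhdsWithin_mono y hHsub (extChartAt_target_mem_nhdsWithin_of_mem hy)
    filter_upwards [h1, self_mem_nhdsWithin] with q hq hqH
    exact A.φ_pt_eq hq hqH
  have hZ : HasFDerivWithinAt (S.φ ∘ A.chart.symm) (0 : E4 →L[ℝ] ℝ) H y :=
    (hasFDerivWithinAt_const _ y H).congr_of_eventuallyEq hconst (A.φ_pt_eq hy hy0)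
  have huniq := (hF.mono hHsub).unique_on hZ
  have hker : ∀ V : E4, V 0 = 0 → L V = 0 := fun V hV =>
    huniq (mem_tangentConeAt_hyperplane hy0 hV)
  -- `L ≠ 0`
  have hLne : L ≠ 0 := by
    intro h0
    apply S.regular _ hz
    ext X'
    have h := DFunLike.congr_fun h0 (tangentCoordChange (𝓡∂ 4) (A.pt y) A.p (A.pt y) X')
    rw [hL, ContinuousLinearMap.comp_apply, A.M_tangentCoordChange hy] at h
    exact h
  change L X = 0 ↔ X 0 = 0
  refine ⟨fun h => ?_, hker X⟩
  by_contra hX0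
  apply hLne
  ext w
  set c : ℝ := w 0 / X 0
  have hw : (w - c • X) 0 = 0 := by
    rw [PiLp.sub_apply, PiLp.smul_apply, smul_eq_mul, div_mul_cancel₀ _ hX0, sub_self]
  have := hker _ hw
  rwa [map_sub, map_smul, h, smul_zero, sub_zero] at this

/-- **The velocity of a smooth loop read in the chart at `p`**: the tangent coordinate change to
the chart at `p` sends `ċ(s)` to the derivative of `chart ∘ K' ∘ circlePt`. [folklore] -/
theorem tangentCoordChange_knotVelocity_of_contMDiff {K' : 𝕊 1 → W}
    (hK' : ContMDiff (𝓡 1) (𝓡∂ 4) ∞ K') {s : ℝ}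
    (hsrc : K' (circlePt s) ∈ (chartAt (EuclideanHalfSpace 4) A.p).source) :
    tangentCoordChange (𝓡∂ 4) (K' (circlePt s)) A.p (K' (circlePt s)) (knotVelocity K' s) =
      deriv (fun t => A.chart (K' (circlePt t))) s := by
  have hKc : MDifferentiableAt 𝓘(ℝ, ℝ) (𝓡∂ 4) (K' ∘ circlePt) s :=
    ((hK'.comp contMDiff_circlePt).contMDiffAt).mdifferentiableAt (by simp)
  have hch : HasMFDerivAt (𝓡∂ 4) 𝓘(ℝ, E4) (extChartAt (𝓡∂ 4) A.p) (K' (circlePt s))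
      (tangentCoordChange (𝓡∂ 4) (K' (circlePt s)) A.p (K' (circlePt s))) := by
    have h := hasMFDerivAt_extChartAt (I := 𝓡∂ 4) hsrc
    rwa [mfderiv_chartAt_eq_tangentCoordChange (I := 𝓡∂ 4) hsrc] at h
  have hcomp := hch.comp s hKc.hasMFDerivAt
  have hγ : HasMFDerivAt 𝓘(ℝ, ℝ) 𝓘(ℝ, E4) (fun t => A.chart (K' (circlePt t))) s
      ((tangentCoordChange (𝓡∂ 4) (K' (circlePt s)) A.p (K' (circlePt s))).comp
        (mfderiv 𝓘(ℝ, ℝ) (𝓡∂ 4) (K' ∘ circlePt) s)) := hcomp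
  have hγ' : HasFDerivAt (fun t => A.chart (K' (circlePt t)))
      (((tangentCoordChange (𝓡∂ 4) (K' (circlePt s)) A.p (K' (circlePt s)) : E4 →L[ℝ] E4)).comp
        (mfderiv 𝓘(ℝ, ℝ) (𝓡∂ 4) (K' ∘ circlePt) s : ℝ →L[ℝ] E4)) s := hγ.hasFDerivAt
  rw [hγ'.hasDerivAt.deriv]
  rfl

/-- **The velocity of a loop written through the chart at `p`**: if near `s` the loop reads
`K' (circlePt t) = pt (h t)` with `h` differentiable into the chart target, then
`ċ(s) = M (h s) (h' s)`. [folklore] -/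
theorem knotVelocity_eq_M {K' : 𝕊 1 → W} (hK' : ContMDiff (𝓡 1) (𝓡∂ 4) ∞ K') {s : ℝ} {h : ℝ → E4}
    {h' : E4} (hh : HasDerivAt h h' s) (hmem : h s ∈ A.chart.target)
    (heq : ∀ᶠ t in 𝓝 s, K' (circlePt t) = A.pt (h t))
    (hmem' : ∀ᶠ t in 𝓝 s, h t ∈ A.chart.target) :
    knotVelocity K' s = A.M (h s) h' := by
  have hs : K' (circlePt s) = A.pt (h s) := heq.self_of_nhds
  have hsrc : K' (circlePt s) ∈ (chartAt (EuclideanHalfSpace 4) A.p).source := by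
    rw [hs]; exact A.pt_mem_source hmem
  have h1 := A.tangentCoordChange_knotVelocity_of_contMDiff hK' hsrc
  have h2 : deriv (fun t => A.chart (K' (circlePt t))) s = h' := by
    refine (hh.congr_of_eventuallyEq ?_).deriv
    filter_upwards [heq, hmem'] with t ht ht'
    rw [ht]; exact A.chart_pt ht'
  rw [h2] at h1
  have h3 := congrArg (A.M (h s)) h1
  rw [show A.M (h s) = A.M (A.chart (K' (circlePt s))) by rw [hs, A.chart_pt hmem]] at h3
  rw [hs] at h3
  rw [A.chart_pt hmem, A.M_tangentCoordChange hmem] at h3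
  exact h3

/-- **The contact form through the chart at `p`**: `α_{pt y}(M y V̂) = α̂_y(V̂)`. [folklore] -/
theorem contactForm_M (y : E4) (V : E4) :
    S.contactForm (A.pt y) (A.M y V) = A.αhat y ![V] := by
  show _ = ((αM S).inChart A.p) y ![V]
  rw [MForm.inChart_apply, ← αM_apply]
  unfold pt M chart
  congr 1
  funext i; fin_cases i; rfl

section SmoothCalc

variable [T2Space W]

/-- **The Kähler form through the chart at `p`**: `ω_{pt y}(M y Û, M y V̂) = (dα̂)_y(Û, V̂)`, the
exterior derivative within the half-space of the chart representative. [folklore] -/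
theorem kahlerForm_M {y : E4} (hy : y ∈ A.chart.target) (U V : E4) :
    S.kahlerForm (A.pt y) (A.M y U) (A.M y V) =
      extDerivWithin A.αhat (range (𝓡∂ 4)) y ![U, V] := by
  have hsm : (αM S).SmoothAt ((extChartAt (𝓡∂ 4) A.p).symm y) :=
    (isSmoothForm_iff_smoothAt _).1 isSmoothForm_αM _
  have h := inChart_mextDeriv_of_mem_target (αM S) (I := 𝓡∂ 4) hy hsm
  have h4 : S.kahlerForm (A.pt y) (A.M y U) (A.M y V) = mextDeriv (αM S) (A.pt y) ![A.M y U, A.M y V] :=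
    (SteinStructure.mextDeriv_liouvilleForm_apply S _ _ _).symm
  rw [h4]
  change _ = extDerivWithin ((αM S).inChart A.p) (range (𝓡∂ 4)) y ![U, V]
  rw [← h, MForm.inChart_apply]
  unfold pt M chart
  congr 1
  funext i; fin_cases i <;> rfl

/-- Naturality of `d` under the affine embedding, at any point of `U`. [folklore] -/
theorem extDeriv_αpull {x : E3} (hx : x ∈ A.U) (u v : E3) :
    extDeriv A.αpull x ![u, v] = extDerivWithin A.αhat (range (𝓡∂ 4)) (A.emb x) ![L3 u, L3 v] := by
  have hdiff : DifferentiableWithinAt ℝ A.αhat (range (𝓡∂ 4)) (A.emb x) :=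
    (A.contDiffWithinAt_αhat hx).differentiableWithinAt (by simp)
  have h := extDerivWithin_pullback (𝕜 := ℝ) (n := 1) (r := ∞) (s := univ) (x := x)
    (t := range (𝓡∂ 4)) (f := A.emb) hdiff A.contDiff_emb.contDiffAt.contDiffWithinAt
    (by rw [minSmoothness_of_isRCLikeNormedField]; exact WithTop.coe_le_coe.2 le_top)
    uniqueDiffOn_univ (by simp) (mem_univ _) (fun x _ => A.emb_mem_range x)
  simp only [fderivWithin_univ, extDerivWithin_univ, (A.hasFDerivAt_emb _).fderiv] at h
  have h1 : (fun x => (A.αhat (A.emb x)).compContinuousLinearMap L3) = A.αpull := rfl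
  rw [h1] at h
  rw [h, ContinuousAlternatingMap.compContinuousLinearMap_apply]
  congr 1
  funext i; fin_cases i <;> rfl

/-- `dαc` is `dα̂` on embedded vectors, at any point of `U`. [folklore] -/
theorem dα_αc_eq {x : E3} (hx : x ∈ A.U) (u v : E3) :
    dα A.αc x u v = extDerivWithin A.αhat (range (𝓡∂ 4)) (A.emb x) ![L3 u, L3 v] := by
  have hd : DifferentiableAt ℝ A.αc x := (A.contDiffAt_αc hx).differentiableAt (by simp)
  rw [← DarbouxData.extDeriv_form1_apply hd]
  have hf : DarbouxData.form1 A.αc = A.αpull := by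
    funext x; rw [αpull_eq]; rfl
  rw [hf, A.extDeriv_αpull hx]

/-- **The box frame.** The tangent vector at the point `pt (emb (Ψ w))` of the window with box
coordinates `ξ`: `bv w ξ = M (emb (Ψ w)) (L3 (DΨ_w ξ))`. [folklore] -/
def bv (w ξ : E3) : E4 := A.M (A.emb (A.darbouxData.Ψ w)) (L3 (fderiv ℝ A.darbouxData.Ψ w ξ))

/-- The base point of the box frame. [folklore] -/
def bpt (w : E3) : W := A.pt (A.emb (A.darbouxData.Ψ w))

/-- Points of the box are chart points. [folklore] -/
theorem emb_Ψ_mem_target {w : E3} (hw : w ∈ A.darbouxData.V) :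
    A.emb (A.darbouxData.Ψ w) ∈ A.chart.target :=
  DarbouxData.Ψ_mem_U (hw := hw)

/-- **`α` on the box frame**: `α(bv w ξ) = g(w) (ξ₂ - w₁ ξ₀)`. [folklore] -/
theorem contactForm_bv {w : E3} (hw : w ∈ A.darbouxData.V) (ξ : E3) :
    S.contactForm (A.bpt w) (A.bv w ξ) = A.darbouxData.g w * (ξ 2 - w 1 * ξ 0) := by
  rw [bpt, bv, contactForm_M, ← αc_apply, ← darbouxData_α, DarbouxData.α_Ψ_fderiv _ hw]

/-- **`ω` on the box frame**: the formula of `DarbouxData.dα_Ψ_fderiv`. [folklore] -/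
theorem kahlerForm_bv {w : E3} (hw : w ∈ A.darbouxData.V) (ξ η : E3) :
    S.kahlerForm (A.bpt w) (A.bv w ξ) (A.bv w η) =
      A.darbouxData.g w * (ξ 0 * η 1 - ξ 1 * η 0) +
        fderiv ℝ A.darbouxData.g w ξ * (η 2 - w 1 * η 0) -
        fderiv ℝ A.darbouxData.g w η * (ξ 2 - w 1 * ξ 0) := by
  rw [bpt, bv, bv, A.kahlerForm_M (A.emb_Ψ_mem_target hw), ← A.dα_αc_eq (DarbouxData.Ψ_mem_U (hw := hw)),
    ← darbouxData_α, DarbouxData.dα_Ψ_fderiv _ hw]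


/-- The box frame is tangent to the boundary. [folklore] -/
theorem bv_apply_zero {w : E3} (hw : w ∈ A.darbouxData.V) (ξ : E3) : A.bv w ξ 0 = 0 :=
  (A.M_apply_zero_iff (A.emb_Ψ_mem_target hw) (A.emb_apply_zero _) _).2 (by simp [L3])

/-- The box frame read back in the chart at `p`. [folklore] -/
theorem tangentCoordChange_bv {w : E3} (hw : w ∈ A.darbouxData.V) (ξ : E3) :
    tangentCoordChange (𝓡∂ 4) (A.bpt w) A.p (A.bpt w) (A.bv w ξ) =
      L3 (fderiv ℝ A.darbouxData.Ψ w ξ) :=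
  A.tangentCoordChange_M (A.emb_Ψ_mem_target hw) _

/-- The box frame is injective in the box coordinates. [folklore] -/
theorem bv_injective {w : E3} (hw : w ∈ A.darbouxData.V) : Injective (A.bv w) := fun ξ₁ ξ₂ h => by
  have h1 := congrArg (tangentCoordChange (𝓡∂ 4) (A.bpt w) A.p (A.bpt w)) h
  rw [A.tangentCoordChange_bv hw, A.tangentCoordChange_bv hw] at h1
  exact DarbouxData.fderiv_Ψ_injective (hw := hw) (L3_injective h1)

/-- The box frame is linear in the box coordinates. [folklore] -/
theorem bv_smul {w : E3} (c : ℝ) (ξ : E3) : A.bv w (c • ξ) = c • A.bv w ξ := by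
  simp only [bv, map_smul]

/-- Transversality in box coordinates gives transversality of the frame vectors. [folklore] -/
theorem bv_not_mem_span {w : E3} (hw : w ∈ A.darbouxData.V) {ξ d : E3} (h : ∀ c : ℝ, ξ ≠ c • d) :
    A.bv w ξ ∉ (ℝ ∙ A.bv w d : Submodule ℝ E4) := by
  rw [Submodule.mem_span_singleton]
  rintro ⟨c, hc⟩
  rw [← A.bv_smul] at hc
  exact h c (A.bv_injective hw hc.symm)

end SmoothCalc

end LegendrianArc
/-! ## Brick T3: the stabilised knot

### The signed parameter distance to the base parameter -/

section SDist

/-- The signed distance `sdist s₀ s ∈ (-1/2, 1/2]` from `s` to `s₀` modulo `1`. [folklore] -/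
def sdist (s₀ s : ℝ) : ℝ := toIocMod one_pos (-(1 / 2 : ℝ)) (s - s₀)

/-- The signed distance lies in `(-1/2, 1/2]`. [folklore] -/
theorem sdist_mem (s₀ s : ℝ) : sdist s₀ s ∈ Ioc (-(1 / 2 : ℝ)) (1 / 2) := by
  have h := toIocMod_mem_Ioc one_pos (-(1 / 2 : ℝ)) (s - s₀)
  rw [show -(1 / 2 : ℝ) + 1 = 1 / 2 by norm_num] at h
  exact h

/-- `|sdist| ≤ 1/2`. [folklore] -/
theorem abs_sdist_le (s₀ s : ℝ) : |sdist s₀ s| ≤ 1 / 2 := by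
  have h := sdist_mem s₀ s
  rw [abs_le]; exact ⟨h.1.le, h.2⟩

/-- `sdist` is `1`-periodic. [folklore] -/
theorem sdist_add_one (s₀ s : ℝ) : sdist s₀ (s + 1) = sdist s₀ s := by
  rw [sdist, sdist, show s + 1 - s₀ = s - s₀ + 1 by ring, toIocMod_add_right]

/-- The signed distance is `1`-periodic (integer shifts). [folklore] -/
theorem sdist_add_int (s₀ s : ℝ) (m : ℤ) : sdist s₀ (s + m) = sdist s₀ s := by
  rw [sdist, sdist, show s + m - s₀ = s - s₀ + m • (1 : ℝ) by simp; ring, toIocMod_add_zsmul]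

/-- There is an integer `m` with `s = s₀ + sdist s₀ s + m`. [folklore] -/
theorem exists_int_eq_add_sdist (s₀ s : ℝ) : ∃ m : ℤ, s = s₀ + sdist s₀ s + m := by
  refine ⟨toIocDiv one_pos (-(1 / 2 : ℝ)) (s - s₀), ?_⟩
  have h := self_sub_toIocDiv_zsmul one_pos (-(1 / 2 : ℝ)) (s - s₀)
  rw [zsmul_eq_mul, mul_one] at h
  rw [sdist]; linarith

/-- `circlePt (s₀ + sdist s₀ s) = circlePt s`. [folklore] -/
theorem circlePt_add_sdist (s₀ s : ℝ) : circlePt (s₀ + sdist s₀ s) = circlePt s := by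
  obtain ⟨m, hm⟩ := exists_int_eq_add_sdist s₀ s
  conv_rhs => rw [hm]
  exact (circlePt_add_int _ m).symm

/-- Near `s₀`, `sdist s₀ s = s - s₀`. [folklore] -/
theorem sdist_eq_sub {s₀ s : ℝ} (h : |s - s₀| < 1 / 2) : sdist s₀ s = s - s₀ := by
  rw [sdist, toIocMod_eq_self]
  rw [abs_lt] at h
  exact ⟨h.1, by linarith [h.2]⟩

/-- `sdist` is locally a translate of the identity wherever it is not at the seam `1/2`. [folklore] -/
theorem sdist_eventuallyEq {s₀ s₁ : ℝ} (h : sdist s₀ s₁ ≠ 1 / 2) :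
    ∃ m : ℤ, (sdist s₀) =ᶠ[𝓝 s₁] fun s => s - s₀ - m := by
  obtain ⟨m, hm⟩ := exists_int_eq_add_sdist s₀ s₁
  refine ⟨m, ?_⟩
  have hlt : sdist s₀ s₁ < 1 / 2 := lt_of_le_of_ne (sdist_mem s₀ s₁).2 h
  have hgt : -(1 / 2 : ℝ) < sdist s₀ s₁ := (sdist_mem s₀ s₁).1
  have hopen : IsOpen {s : ℝ | s - s₀ - m ∈ Ioo (-(1 / 2 : ℝ)) (1 / 2)} :=
    isOpen_Ioo.preimage (by fun_prop)
  have hmem : s₁ ∈ {s : ℝ | s - s₀ - m ∈ Ioo (-(1 / 2 : ℝ)) (1 / 2)} := by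
    show s₁ - s₀ - m ∈ Ioo (-(1 / 2 : ℝ)) (1 / 2)
    rw [show s₁ - s₀ - m = sdist s₀ s₁ by linarith]
    exact ⟨hgt, hlt⟩
  filter_upwards [hopen.mem_nhds hmem] with s hs
  have h1 : sdist s₀ s = sdist s₀ (s - m) := by
    have := sdist_add_int s₀ (s - m) m
    rw [sub_add_cancel] at this; exact this
  rw [h1, sdist_eq_sub (by rw [show s - ↑m - s₀ = s - s₀ - m by ring]; exact abs_lt.2 ⟨hs.1, hs.2⟩)]
  ring

/-- The signed distance is smooth off the antipode. [folklore] -/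
theorem contDiffAt_sdist {s₀ s₁ : ℝ} (h : sdist s₀ s₁ ≠ 1 / 2) : ContDiffAt ℝ ∞ (sdist s₀) s₁ := by
  obtain ⟨m, hm⟩ := sdist_eventuallyEq h
  exact ((contDiffAt_id.sub contDiffAt_const).sub contDiffAt_const).congr_of_eventuallyEq hm

/-- The signed distance has derivative `1` off the antipode. [folklore] -/
theorem hasDerivAt_sdist {s₀ s₁ : ℝ} (h : sdist s₀ s₁ ≠ 1 / 2) : HasDerivAt (sdist s₀) 1 s₁ := by
  obtain ⟨m, hm⟩ := sdist_eventuallyEq h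
  have : HasDerivAt (fun s : ℝ => s - s₀ - m) 1 s₁ := by
    simpa using ((hasDerivAt_id s₁).sub_const s₀).sub_const (m : ℝ)
  exact this.congr_of_eventuallyEq hm

/-- Inside the open window `|sdist| < w` with `w ≤ 1/2` we are away from the seam. [folklore] -/
theorem sdist_ne_half_of_abs_lt {s₀ s w : ℝ} (hw : w ≤ 1 / 2) (h : |sdist s₀ s| < w) : sdist s₀ s ≠ 1 / 2 := by
  intro h'
  rw [h', abs_of_pos (by norm_num : (0:ℝ) < 1 / 2)] at h
  linarith

/-- `sdist s₀ s₀ = 0`. [folklore] -/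
@[simp] theorem sdist_self (s₀ : ℝ) : sdist s₀ s₀ = 0 := by
  rw [sdist_eq_sub (by simp)]; simp

/-- `|sdist|` is continuous off the antipode. [folklore] -/
theorem continuousAt_abs_sdist {s₀ s₁ : ℝ} (h : sdist s₀ s₁ ≠ 1 / 2) :
    ContinuousAt (fun s => |sdist s₀ s|) s₁ :=
  continuous_abs.continuousAt.comp (contDiffAt_sdist h).continuousAt

end SDist


/-! ### The stabilisation data and the modified knots -/

variable [T2Space W]

/-- **Stabilisation data**: a Legendrian arc together with a model scale `ε`, a window
half-width `w₀` and a box half-width `ℓ` subject to the compatibility conditions under which the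
modified knots below are well behaved. [folklore] -/
structure StabData (S : SteinStructure W) extends LegendrianArc S where
  /-- the model scale -/
  ε : ℝ
  /-- the window half-width (in the knot parameter) -/
  w₀ : ℝ
  /-- the box half-width (in the Darboux coordinates) -/
  ℓ : ℝ
  ε_pos : 0 < ε
  ε_le_one : ε ≤ 1
  w₀_le : w₀ ≤ 1 / 4
  ε_le_w₀ : 16 * ε ≤ w₀
  /-- the model curves stay in the box -/
  w₀_add_lt_ℓ : w₀ + ε * LegendrianModel.Cmodel < ℓ
  /-- the box lies in the domain of the Darboux box -/
  box_subset : DarbouxData.box ℓ ⊆ toLegendrianArc.darbouxData.V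
  /-- the axis segment satisfies the side conditions of the Darboux box -/
  axis_mem : ∀ x : ℝ, |x| < ℓ → (x • DarbouxData.e 0 : E3) ∈ toLegendrianArc.darbouxData.V ∧
    (x • DarbouxData.e 0 : E3) ∈ toLegendrianArc.darbouxData.V₀ ∧
    (x • DarbouxData.e 0 : E3) ∈ toLegendrianArc.darbouxData.Φ₁.source
  /-- **separation**: the transported model curves over the core of the window stay away from
  the part of the knot outside the window -/
  sep : ∀ τ ∈ Icc (0 : ℝ) 1, ∀ t : ℝ, |t| < 4 * ε → ∀ s : ℝ, w₀ ≤ |sdist toLegendrianArc.s₀ s| →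
    (extChartAt (𝓡∂ 4) toLegendrianArc.p).symm (toLegendrianArc.emb
      (toLegendrianArc.darbouxData.Ψ (LegendrianModel.scurve ε τ t))) ≠ toLegendrianArc.K (circlePt s)

namespace StabData

variable {S : SteinStructure W} (X : StabData S)

/-- The Darboux data of the arc. [folklore] -/
abbrev D : DarbouxData := X.toLegendrianArc.darbouxData

/-- The window is nondegenerate. [folklore] -/
theorem w₀_pos : 0 < X.w₀ := by linarith [X.ε_pos, X.ε_le_w₀]

/-- The box is nondegenerate. [folklore] -/
theorem ℓ_pos : 0 < X.ℓ := by
  have := X.w₀_add_lt_ℓ; have := X.w₀_pos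
  have : 0 < X.ε * LegendrianModel.Cmodel := mul_pos X.ε_pos LegendrianModel.Cmodel_pos
  linarith

/-- The window fits in the box. [folklore] -/
theorem w₀_lt_ℓ : X.w₀ < X.ℓ := by
  have : 0 < X.ε * LegendrianModel.Cmodel := mul_pos X.ε_pos LegendrianModel.Cmodel_pos
  linarith [X.w₀_add_lt_ℓ]

/-- The core of the window lies inside the window. [folklore] -/
theorem four_ε_lt_w₀ : 4 * X.ε < X.w₀ := by linarith [X.ε_pos, X.ε_le_w₀]

/-- The window is shorter than half a period. [folklore] -/
theorem w₀_le_half : X.w₀ ≤ 1 / 2 := by linarith [X.w₀_le]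

/-- The model axis point is the axis point of the Darboux box. [folklore] -/
theorem axisPt_eq (x : ℝ) : LegendrianModel.axisPt x = (x • DarbouxData.e 0 : E3) :=
  LegendrianModel.euclidean_three_ext (by simp) (by simp [DarbouxData.e_apply])
    (by simp [DarbouxData.e_apply])

/-- **The Darboux box read in `W`**: `Wpt w = chart⁻¹ (emb (Ψ w))`. [folklore] -/
def Wpt (w : E3) : W := X.chart.symm (X.emb (X.D.Ψ w))

/-- On the axis, the Darboux box read in `W` is the knot. [folklore] -/
theorem Wpt_axis {x : ℝ} (hx : |x| < X.ℓ) : X.Wpt (x • DarbouxData.e 0) = X.K (circlePt (X.s₀ + x)) := by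
  obtain ⟨-, hV₀, hsrc⟩ := X.axis_mem x hx
  have hIv : X.s₀ + x ∈ X.Iv := by
    have h := hV₀.2
    simp only [PiLp.smul_apply, DarbouxData.e_apply_same, smul_eq_mul, mul_one] at h
    exact h
  rw [Wpt, DarbouxData.Ψ_axis _ hV₀ hsrc]
  show X.chart.symm (X.emb (X.chat (X.s₀ + x))) = _
  rw [X.emb_chat hIv]
  exact X.chart.left_inv (X.mem_extSource_of_mem_Iv hIv)

/-- **The modified curve family on the parameter line**: inside the window the model curves
transported by the Darboux box, outside the original knot. [folklore] -/
def G (τ s : ℝ) : W :=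
  if |sdist X.s₀ s| < X.w₀ then X.Wpt (LegendrianModel.scurve X.ε (Real.smoothTransition τ) (sdist X.s₀ s))
  else X.K (circlePt s)

/-- The clamped time lies in `[0, 1]`. [folklore] -/
theorem smoothTransition_mem (τ : ℝ) : Real.smoothTransition τ ∈ Icc (0 : ℝ) 1 :=
  ⟨Real.smoothTransition.nonneg τ, Real.smoothTransition.le_one τ⟩

/-- `G` on the window. [folklore] -/
theorem G_of_lt {τ s : ℝ} (h : |sdist X.s₀ s| < X.w₀) :
    X.G τ s = X.Wpt (LegendrianModel.scurve X.ε (Real.smoothTransition τ) (sdist X.s₀ s)) := by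
  rw [G, if_pos h]

/-- `G` off the window. [folklore] -/
theorem G_of_le {τ s : ℝ} (h : X.w₀ ≤ |sdist X.s₀ s|) : X.G τ s = X.K (circlePt s) := by
  rw [G, if_neg (not_lt.2 h)]

/-- **Branch agreement**: for `4ε ≤ |sdist| < ℓ` the transported model curve is the knot. [folklore] -/
theorem Wpt_scurve_eq {τ s : ℝ} (h1 : 4 * X.ε ≤ |sdist X.s₀ s|) (h2 : |sdist X.s₀ s| < X.ℓ) :
    X.Wpt (LegendrianModel.scurve X.ε τ (sdist X.s₀ s)) = X.K (circlePt s) := by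
  rw [LegendrianModel.scurve_eq_axisPt X.ε_pos h1, axisPt_eq, X.Wpt_axis h2, circlePt_add_sdist]

/-- `G` is `1`-periodic in the parameter. [folklore] -/
theorem G_add_one (τ s : ℝ) : X.G τ (s + 1) = X.G τ s := by
  simp only [G, sdist_add_one]
  rw [show s + 1 = s + ((1 : ℤ) : ℝ) by simp, circlePt_add_int]

/-- `G τ` is `1`-periodic (integer shifts). [folklore] -/
theorem G_add_int (τ s : ℝ) (m : ℤ) : X.G τ (s + m) = X.G τ s := by
  simp only [G, sdist_add_int, circlePt_add_int]

/-- Near a parameter with `4ε < |sdist| < ℓ`-room, `G` is the knot. [folklore] -/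
theorem G_eq_K_of_mem {τ s : ℝ} (h : 4 * X.ε < |sdist X.s₀ s|) : X.G τ s = X.K (circlePt s) := by
  by_cases hw : |sdist X.s₀ s| < X.w₀
  · rw [X.G_of_lt hw, X.Wpt_scurve_eq h.le (hw.trans X.w₀_lt_ℓ)]
  · exact X.G_of_le (not_lt.1 hw)

/-- **The modified knots** `K_τ z = G τ (angA z)`. [folklore] -/
def knot (τ : ℝ) (z : 𝕊 1) : W := X.G τ (angA z)

/-- `K_τ ∘ circlePt = G τ`. [folklore] -/
theorem knot_circlePt (τ s : ℝ) : X.knot τ (circlePt s) = X.G τ s := by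
  obtain ⟨m, hm⟩ := circlePt_eq_circlePt_iff.1 (circlePt_angA (circlePt s))
  rw [knot, hm, G_add_int]

/-- `K_τ = G τ ∘ angB` as well (periodicity). [folklore] -/
theorem knot_eq_G_angB (τ : ℝ) (z : 𝕊 1) : X.knot τ z = X.G τ (angB z) := by
  conv_lhs => rw [← circlePt_angB z]
  exact X.knot_circlePt τ (angB z)


/-! ### Smoothness of the modified family -/

/-- The model curve of the family at clamped time `τ` and window parameter of `s`. [folklore] -/
def mcurve (q : ℝ × ℝ) : E3 := LegendrianModel.scurve X.ε (Real.smoothTransition q.1) (sdist X.s₀ q.2)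

/-- The model point is smooth in `(τ, s)` off the antipode. [folklore] -/
theorem contDiffAt_mcurve {q : ℝ × ℝ} (hq : sdist X.s₀ q.2 ≠ 1 / 2) : ContDiffAt ℝ ∞ X.mcurve q := by
  have h1 : ContDiffAt ℝ ∞ (fun q : ℝ × ℝ => (Real.smoothTransition q.1, sdist X.s₀ q.2)) q :=
    (Real.smoothTransition.contDiff.contDiffAt.comp q contDiffAt_fst).prodMk
      ((contDiffAt_sdist hq).comp q contDiffAt_snd)
  exact (LegendrianModel.contDiff_scurve X.ε).contDiffAt.comp q h1

/-- Points of the model curves over the window lie in the box. [folklore] -/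
theorem scurve_mem_box {τ t : ℝ} (hτ : τ ∈ Icc (0 : ℝ) 1) (ht : |t| < X.w₀) :
    LegendrianModel.scurve X.ε τ t ∈ DarbouxData.box X.ℓ := by
  have hb := LegendrianModel.norm_scurve_sub_axisPt_le X.ε_pos X.ε_le_one hτ t
  have hlt := X.w₀_add_lt_ℓ
  intro i
  have hi : |(LegendrianModel.scurve X.ε τ t - LegendrianModel.axisPt t) i| ≤ X.ε * LegendrianModel.Cmodel :=
    le_trans (by simpa using PiLp.norm_apply_le (LegendrianModel.scurve X.ε τ t - LegendrianModel.axisPt t) i) hb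
  have hax : |LegendrianModel.axisPt t i| ≤ |t| := by
    fin_cases i <;> simp
  have : LegendrianModel.scurve X.ε τ t i =
      (LegendrianModel.scurve X.ε τ t - LegendrianModel.axisPt t) i + LegendrianModel.axisPt t i := by simp
  rw [this]
  calc |(LegendrianModel.scurve X.ε τ t - LegendrianModel.axisPt t) i + LegendrianModel.axisPt t i|
        ≤ |(LegendrianModel.scurve X.ε τ t - LegendrianModel.axisPt t) i| + |LegendrianModel.axisPt t i| :=
          abs_add_le _ _
      _ < X.ℓ := by linarith

/-- The model points of the window lie in the box. [folklore] -/
theorem mcurve_mem_box {q : ℝ × ℝ} (hq : |sdist X.s₀ q.2| < X.w₀) : X.mcurve q ∈ DarbouxData.box X.ℓ :=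
  X.scurve_mem_box (smoothTransition_mem q.1) hq

/-- The box lies in the domain of the Darboux box. [folklore] -/
theorem box_subset_V : DarbouxData.box X.ℓ ⊆ X.D.V := X.box_subset

/-- The hyperplane point of a box point lies in the chart target. [folklore] -/
theorem emb_Ψ_mem_target {w : E3} (hw : w ∈ X.D.V) : X.emb (X.D.Ψ w) ∈ X.chart.target :=
  X.emb_mem_target (DarbouxData.Ψ_mem_U hw)

/-- **Smoothness of the Darboux box read in `W`, composed with a smooth map into the box.**
[folklore] -/
theorem contMDiffAt_Wpt_comp {P : Type*} [TopologicalSpace P] {EP : Type*} [NormedAddCommGroup EP]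
    [NormedSpace ℝ EP] {HP : Type*} [TopologicalSpace HP] {IP : ModelWithCorners ℝ EP HP} [ChartedSpace HP P]
    {h : P → E3} {q : P} (hh : ContMDiffAt IP 𝓘(ℝ, E3) ∞ h q) (hq : h q ∈ X.D.V) :
    ContMDiffAt IP (𝓡∂ 4) ∞ (fun q => X.Wpt (h q)) q := by
  -- the set where `h` lands in `V` is open around `q`
  have hopen : ∀ᶠ q' in 𝓝 q, h q' ∈ X.D.V := hh.continuousAt.preimage_mem_nhds (X.D.isOpen_V.mem_nhds hq)
  -- `emb ∘ Ψ ∘ h` is smooth at `q` into `E4`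
  have h1 : ContMDiffAt IP 𝓘(ℝ, E4) ∞ (fun q' => X.emb (X.D.Ψ (h q'))) q := by
    have hΨ : ContMDiffAt 𝓘(ℝ, E3) 𝓘(ℝ, E4) ∞ (fun w => X.emb (X.D.Ψ w)) (h q) :=
      contMDiffAt_iff_contDiffAt.2 (X.contDiff_emb.contDiffAt.comp _ (DarbouxData.contDiffAt_Ψ hq))
    exact hΨ.comp q hh
  -- compose with the inverse chart
  have h2 : ContMDiffWithinAt 𝓘(ℝ, E4) (𝓡∂ 4) ∞ X.chart.symm X.chart.target (X.emb (X.D.Ψ (h q))) :=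
    (contMDiffOn_extChartAt_symm (I := 𝓡∂ 4) X.p) _ (X.emb_Ψ_mem_target hq)
  have h3 : ContMDiffWithinAt IP (𝓡∂ 4) ∞ (X.chart.symm ∘ fun q' => X.emb (X.D.Ψ (h q')))
      ((fun q' => X.emb (X.D.Ψ (h q'))) ⁻¹' X.chart.target) q :=
    h2.comp q (h1.contMDiffWithinAt) fun q' hq' => hq'
  refine h3.contMDiffAt ?_
  filter_upwards [hopen] with q' hq'
  exact X.emb_Ψ_mem_target hq'


/-- **The window**: parameters with `|sdist| < w₀`. [folklore] -/
def winSet : Set ℝ := {s | |sdist X.s₀ s| < X.w₀}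

/-- **The far set**: parameters at `sdist`-distance more than `4ε` from the base parameter (an open
description avoiding the seam of `sdist`). [folklore] -/
def farSet : Set ℝ := {s | ∃ m : ℤ, s - X.s₀ - m ∈ Ioo (4 * X.ε) (1 - 4 * X.ε)}

/-- Window parameters are not antipodal. [folklore] -/
theorem sdist_ne_half_of_mem_winSet {s : ℝ} (hs : s ∈ X.winSet) : sdist X.s₀ s ≠ 1 / 2 :=
  sdist_ne_half_of_abs_lt X.w₀_le_half hs

/-- The window is open. [folklore] -/
theorem isOpen_winSet : IsOpen X.winSet := by
  rw [isOpen_iff_mem_nhds]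
  intro s hs
  exact (continuousAt_abs_sdist (X.sdist_ne_half_of_mem_winSet hs)).preimage_mem_nhds (isOpen_Iio.mem_nhds hs)

/-- The far set is open. [folklore] -/
theorem isOpen_farSet : IsOpen X.farSet := by
  have h : X.farSet = ⋃ m : ℤ, (fun s : ℝ => s - X.s₀ - m) ⁻¹' Ioo (4 * X.ε) (1 - 4 * X.ε) := by
    ext s; simp [farSet]
  rw [h]
  exact isOpen_iUnion fun m => isOpen_Ioo.preimage (by fun_prop)

/-- On the far set, `|sdist| > 4ε`. [folklore] -/
theorem four_ε_lt_abs_sdist {s : ℝ} (hs : s ∈ X.farSet) : 4 * X.ε < |sdist X.s₀ s| := by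
  obtain ⟨m, hm⟩ := hs
  have hε := X.ε_pos
  -- `sdist s = s - s₀ - m` or `s - s₀ - m - 1`
  have key : sdist X.s₀ s = s - X.s₀ - m ∨ sdist X.s₀ s = s - X.s₀ - m - 1 := by
    rcases le_or_gt (s - X.s₀ - m) (1 / 2) with h | h
    · left
      rw [sdist, toIocMod_eq_iff]
      exact ⟨⟨by linarith [hm.1], by linarith⟩, m, by simp⟩
    · right
      rw [sdist, toIocMod_eq_iff]
      exact ⟨⟨by linarith, by linarith [hm.2]⟩, m + 1, by simp⟩
  rcases key with h | h
  · rw [h, abs_of_pos (by linarith [hm.1])]; exact hm.1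
  · rw [h, abs_of_neg (by linarith [hm.2])]; linarith [hm.2]

/-- Every parameter is in the window or in the far set. [folklore] -/
theorem mem_winSet_or_farSet (s : ℝ) : s ∈ X.winSet ∨ s ∈ X.farSet := by
  by_cases h : |sdist X.s₀ s| < X.w₀
  · exact Or.inl h
  · right
    rw [not_lt] at h
    obtain ⟨m, hm⟩ := exists_int_eq_add_sdist X.s₀ s
    have hmem := sdist_mem X.s₀ s
    have h4 := X.four_ε_lt_w₀
    have hw := X.w₀_le
    rcases le_or_gt 0 (sdist X.s₀ s) with hpos | hneg
    · rw [abs_of_nonneg hpos] at h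
      exact ⟨m, by rw [show s - X.s₀ - m = sdist X.s₀ s by linarith]; exact ⟨by linarith, by linarith [hmem.2]⟩⟩
    · rw [abs_of_neg hneg] at h
      exact ⟨m - 1, by
        rw [show s - X.s₀ - ((m - 1 : ℤ) : ℝ) = sdist X.s₀ s + 1 by push_cast; linarith]
        exact ⟨by linarith [hmem.1], by linarith⟩⟩

/-- On the far set, `G` is the original knot. [folklore] -/
theorem G_eq_of_mem_farSet {s : ℝ} (hs : s ∈ X.farSet) (τ : ℝ) : X.G τ s = X.K (circlePt s) :=
  X.G_eq_K_of_mem (X.four_ε_lt_abs_sdist hs)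

/-- On the window, `G` is the transported model curve. [folklore] -/
theorem G_eq_of_mem_winSet {s : ℝ} (hs : s ∈ X.winSet) (τ : ℝ) : X.G τ s = X.Wpt (X.mcurve (τ, s)) :=
  X.G_of_lt hs

/-- The original knot along the parameter line is smooth. [folklore] -/
theorem contMDiff_K_circlePt : ContMDiff 𝓘(ℝ, ℝ) (𝓡∂ 4) ∞ fun s => X.K (circlePt s) :=
  X.legendrian.isSmoothEmbedding.contMDiff.comp contMDiff_circlePt

/-- **`G` is jointly smooth.** [folklore] -/
theorem contMDiffAt_G_uncurry (q : ℝ × ℝ) :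
    ContMDiffAt 𝓘(ℝ, ℝ × ℝ) (𝓡∂ 4) ∞ (fun q : ℝ × ℝ => X.G q.1 q.2) q := by
  rcases X.mem_winSet_or_farSet q.2 with h | h
  · have hev : (fun q : ℝ × ℝ => X.G q.1 q.2) =ᶠ[𝓝 q] fun q => X.Wpt (X.mcurve q) := by
      filter_upwards [continuous_snd.continuousAt.preimage_mem_nhds (X.isOpen_winSet.mem_nhds h)] with q' hq'
      exact X.G_eq_of_mem_winSet hq' q'.1
    refine ContMDiffAt.congr_of_eventuallyEq ?_ hev
    exact X.contMDiffAt_Wpt_comp (contMDiffAt_iff_contDiffAt.2 (X.contDiffAt_mcurve (X.sdist_ne_half_of_mem_winSet h)))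
      (X.box_subset_V (X.mcurve_mem_box h))
  · have hev : (fun q : ℝ × ℝ => X.G q.1 q.2) =ᶠ[𝓝 q] fun q => X.K (circlePt q.2) := by
      filter_upwards [continuous_snd.continuousAt.preimage_mem_nhds (X.isOpen_farSet.mem_nhds h)] with q' hq'
      exact X.G_eq_of_mem_farSet hq' q'.1
    refine ContMDiffAt.congr_of_eventuallyEq ?_ hev
    exact (X.contMDiff_K_circlePt.comp contDiff_snd.contMDiff).contMDiffAt

/-- `G` is jointly smooth (global form). [folklore] -/
theorem contMDiff_G_uncurry : ContMDiff 𝓘(ℝ, ℝ × ℝ) (𝓡∂ 4) ∞ fun q : ℝ × ℝ => X.G q.1 q.2 :=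
  fun q => X.contMDiffAt_G_uncurry q

/-- **The family of modified knots is jointly smooth** on `ℝ × S¹`. [folklore] -/
theorem contMDiff_knot_uncurry : ContMDiff (𝓘(ℝ, ℝ).prod (𝓡 1)) (𝓡∂ 4) ∞ (uncurry X.knot) := by
  intro q
  by_cases h : q.2 = ptA
  · have heq : uncurry X.knot = (fun q : ℝ × ℝ => X.G q.1 q.2) ∘ fun q : ℝ × (𝕊 1) => (q.1, angB q.2) := by
      funext q'; exact X.knot_eq_G_angB q'.1 q'.2
    rw [heq]
    have hB : q.2 ≠ ptB := by rw [h]; exact ptA_ne_ptB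
    exact (X.contMDiffAt_G_uncurry _).comp q
      (contMDiffAt_fst.prodMk_space ((contMDiffAt_angB hB).comp q contMDiffAt_snd))
  · have heq : uncurry X.knot = (fun q : ℝ × ℝ => X.G q.1 q.2) ∘ fun q : ℝ × (𝕊 1) => (q.1, angA q.2) := by
      funext q'; rfl
    rw [heq]
    exact (X.contMDiffAt_G_uncurry _).comp q
      (contMDiffAt_fst.prodMk_space ((contMDiffAt_angA h).comp q contMDiffAt_snd))

/-- Each modified knot is smooth. [folklore] -/
theorem contMDiff_knot (τ : ℝ) : ContMDiff (𝓡 1) (𝓡∂ 4) ∞ (X.knot τ) := by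
  have h : X.knot τ = uncurry X.knot ∘ fun z : 𝕊 1 => (τ, z) := rfl
  rw [h]
  exact X.contMDiff_knot_uncurry.comp (contMDiff_const.prodMk contMDiff_id)


/-! ### Boundary values, the initial stage, and the far region -/

/-- Points of the Darboux box read in `W` are boundary points. [folklore] -/
theorem isBoundaryPoint_Wpt {w : E3} (hw : w ∈ X.D.V) : (𝓡∂ 4).IsBoundaryPoint (X.Wpt w) := by
  have ht := X.emb_Ψ_mem_target hw
  have hsrc : X.Wpt w ∈ (chartAt (EuclideanHalfSpace 4) X.p).source := by
    rw [← extChartAt_source (𝓡∂ 4)]; exact X.chart.map_target ht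
  rw [isBoundaryPoint_iff_apply_zero hsrc]
  show X.chart (X.chart.symm (X.emb (X.D.Ψ w))) 0 = 0
  rw [X.chart.right_inv ht]
  exact X.emb_apply_zero _

/-- **Every stage lies in the boundary.** [folklore] -/
theorem isBoundaryPoint_knot (τ : ℝ) (z : 𝕊 1) : (𝓡∂ 4).IsBoundaryPoint (X.knot τ z) := by
  rw [knot]
  rcases X.mem_winSet_or_farSet (angA z) with h | h
  · rw [X.G_eq_of_mem_winSet h]
    exact X.isBoundaryPoint_Wpt (X.box_subset_V (X.mcurve_mem_box h))
  · rw [X.G_eq_of_mem_farSet h]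
    exact X.legendrian.isBoundaryPoint _

/-- At time `0` (indeed at all non-positive times) the family is the original knot on the parameter
line. [folklore] -/
theorem G_of_nonpos {τ : ℝ} (hτ : τ ≤ 0) (s : ℝ) : X.G τ s = X.K (circlePt s) := by
  rcases X.mem_winSet_or_farSet s with h | h
  · rw [X.G_eq_of_mem_winSet h, mcurve, Real.smoothTransition.zero_of_nonpos hτ,
      LegendrianModel.scurve_zero_left _ X.ε_pos.ne', axisPt_eq, X.Wpt_axis (lt_trans h X.w₀_lt_ℓ),
      circlePt_add_sdist]
  · exact X.G_eq_of_mem_farSet h τ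

/-- **The family starts at `K`.** [folklore] -/
theorem knot_zero : X.knot 0 = X.K := by
  funext z
  rw [knot, X.G_of_nonpos le_rfl, circlePt_angA]

/-- Near a point of the far set (read through `angA`), the stage is the original knot. [folklore] -/
theorem knot_eventuallyEq_of_mem_farSet {τ : ℝ} {z : 𝕊 1} (hz : angA z ∈ X.farSet) (hA : z ≠ ptA) :
    X.knot τ =ᶠ[𝓝 z] X.K := by
  have hc : ContinuousAt angA z := (contMDiffAt_angA hA).continuousAt
  filter_upwards [hc.preimage_mem_nhds (X.isOpen_farSet.mem_nhds hz)] with z' hz'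
  rw [knot, X.G_eq_of_mem_farSet hz', circlePt_angA]

/-- Near a point of the far set (read through `angB`), the stage is the original knot. [folklore] -/
theorem knot_eventuallyEq_of_mem_farSet' {τ : ℝ} {z : 𝕊 1} (hz : angB z ∈ X.farSet) (hB : z ≠ ptB) :
    X.knot τ =ᶠ[𝓝 z] X.K := by
  have hc : ContinuousAt angB z := (contMDiffAt_angB hB).continuousAt
  filter_upwards [hc.preimage_mem_nhds (X.isOpen_farSet.mem_nhds hz)] with z' hz'
  rw [X.knot_eq_G_angB, X.G_eq_of_mem_farSet hz', circlePt_angB]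

/-- `angA` and `angB` differ by an integer, so membership in the far set is the same. [folklore] -/
theorem angB_mem_farSet_iff {z : 𝕊 1} (hA : z ≠ ptA) (hB : z ≠ ptB) :
    angB z ∈ X.farSet ↔ angA z ∈ X.farSet := by
  rcases angB_eq_of_ne hA hB with ⟨-, h⟩ | ⟨-, h⟩
  · rw [h]
    constructor
    · rintro ⟨m, hm⟩
      exact ⟨m - 1, by push_cast; rw [show angA z - X.s₀ - (m - 1) = angA z + 1 - X.s₀ - m by ring]; exact hm⟩
    · rintro ⟨m, hm⟩
      exact ⟨m + 1, by push_cast; rw [show angA z + 1 - X.s₀ - (m + 1) = angA z - X.s₀ - m by ring]; exact hm⟩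
  · rw [h]


/-! ### Injectivity of the stages -/

/-- The separation field, restated. [folklore] -/
theorem Wpt_scurve_ne {τ t s : ℝ} (hτ : τ ∈ Icc (0 : ℝ) 1) (ht : |t| < 4 * X.ε) (hs : X.w₀ ≤ |sdist X.s₀ s|) :
    X.Wpt (LegendrianModel.scurve X.ε τ t) ≠ X.K (circlePt s) :=
  X.sep τ hτ t ht s hs

/-- `Wpt` is injective on the domain of the Darboux box. [folklore] -/
theorem Wpt_injOn : InjOn X.Wpt X.D.V := by
  intro w₁ h₁ w₂ h₂ h
  have h' : X.emb (X.D.Ψ w₁) = X.emb (X.D.Ψ w₂) := by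
    have := congrArg X.chart h
    simp only [Wpt] at this
    rwa [X.chart.right_inv (X.emb_Ψ_mem_target h₁), X.chart.right_inv (X.emb_Ψ_mem_target h₂)] at this
  exact DarbouxData.injOn_Ψ _ h₁ h₂ (X.emb_injective h')

/-- Window stages at two window parameters agree only over the same circle point. [folklore] -/
theorem circlePt_eq_of_Wpt_mcurve_eq {τ s₁ s₂ : ℝ} (h₁ : s₁ ∈ X.winSet) (h₂ : s₂ ∈ X.winSet)
    (h : X.Wpt (X.mcurve (τ, s₁)) = X.Wpt (X.mcurve (τ, s₂))) : circlePt s₁ = circlePt s₂ := by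
  have hm := X.Wpt_injOn (X.box_subset_V (X.mcurve_mem_box (q := (τ, s₁)) h₁))
    (X.box_subset_V (X.mcurve_mem_box (q := (τ, s₂)) h₂)) h
  have hs : sdist X.s₀ s₁ = sdist X.s₀ s₂ :=
    LegendrianModel.scurve_injective X.ε_pos.ne' (smoothTransition_mem τ) hm
  rw [← circlePt_add_sdist X.s₀ s₁, ← circlePt_add_sdist X.s₀ s₂, hs]

/-- **Every stage is injective.** [folklore] -/
theorem knot_injective (τ : ℝ) : Injective (X.knot τ) := by
  intro z₁ z₂ h
  have hK := X.legendrian.isSmoothEmbedding.isEmbedding.injective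
  rw [knot, knot] at h
  -- reduce to circle points
  suffices hc : circlePt (angA z₁) = circlePt (angA z₂) by simpa using hc
  set s₁ := angA z₁
  set s₂ := angA z₂
  have hτ := smoothTransition_mem τ
  -- a window parameter with `|sdist| < 4ε` against a non-window parameter is excluded by `sep`
  have key : ∀ a b : ℝ, a ∈ X.winSet → b ∉ X.winSet → X.G τ a = X.G τ b → circlePt a = circlePt b := by
    intro a b ha hb hab
    rw [X.G_eq_of_mem_winSet ha, X.G_of_le (not_lt.1 hb)] at hab
    by_cases h4 : |sdist X.s₀ a| < 4 * X.ε
    · exact absurd hab (X.Wpt_scurve_ne hτ h4 (not_lt.1 hb))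
    · rw [mcurve, LegendrianModel.scurve_eq_axisPt X.ε_pos (not_lt.1 h4), axisPt_eq,
        X.Wpt_axis (lt_trans ha X.w₀_lt_ℓ), circlePt_add_sdist] at hab
      exact hK hab
  by_cases ha : s₁ ∈ X.winSet <;> by_cases hb : s₂ ∈ X.winSet
  · rw [X.G_eq_of_mem_winSet ha, X.G_eq_of_mem_winSet hb] at h
    exact X.circlePt_eq_of_Wpt_mcurve_eq ha hb h
  · exact key s₁ s₂ ha hb h
  · exact (key s₂ s₁ hb ha h.symm).symm
  · rw [X.G_of_le (not_lt.1 ha), X.G_of_le (not_lt.1 hb)] at h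
    exact hK h

/-! ### The stages are immersions and embeddings -/

/-- `angB z - angA z` is an integer. [folklore] -/
theorem exists_int_angB_eq (z : 𝕊 1) : ∃ m : ℤ, angB z = angA z + m := by
  have h : circlePt (angB z) = circlePt (angA z) := by rw [circlePt_angB, circlePt_angA]
  rw [circlePt_eq_circlePt_iff] at h
  exact h

/-- Membership in the far set is invariant under integer shifts. [folklore] -/
theorem add_int_mem_farSet_iff (s : ℝ) (m : ℤ) : s + m ∈ X.farSet ↔ s ∈ X.farSet := by
  constructor
  · rintro ⟨k, hk⟩
    exact ⟨k - m, by push_cast; rw [show s - X.s₀ - (k - m) = s + m - X.s₀ - k by ring]; exact hk⟩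
  · rintro ⟨k, hk⟩
    exact ⟨k + m, by push_cast; rw [show s + m - X.s₀ - (k + m) = s - X.s₀ - k by ring]; exact hk⟩

/-- `angA` and `angB` differ by an integer, so membership in the far set is the same. [folklore] -/
theorem angB_mem_farSet_iff' (z : 𝕊 1) : angB z ∈ X.farSet ↔ angA z ∈ X.farSet := by
  obtain ⟨m, hm⟩ := exists_int_angB_eq z
  rw [hm, X.add_int_mem_farSet_iff]

/-- The model map of a stage, as a function of the base parameter. [folklore] -/
def gline (τ : ℝ) (s : ℝ) : E3 := X.D.Ψ (X.mcurve (τ, s))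

/-- The model map of a stage is smooth at window parameters. [folklore] -/
theorem contDiffAt_gline {τ s : ℝ} (hs : s ∈ X.winSet) : ContDiffAt ℝ ∞ (X.gline τ) s := by
  have h1 : ContDiffAt ℝ ∞ X.mcurve (τ, s) := X.contDiffAt_mcurve (X.sdist_ne_half_of_mem_winSet hs)
  have h2 : ContDiffAt ℝ ∞ X.D.Ψ (X.mcurve (τ, s)) :=
    X.D.contDiffAt_Ψ (X.box_subset_V (X.mcurve_mem_box (q := (τ, s)) hs))
  exact h2.comp s (h1.comp s (contDiffAt_const.prodMk contDiffAt_id))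

/-- The derivative of the model map of a stage in the base parameter. [folklore] -/
theorem hasDerivAt_gline {τ s : ℝ} (hs : s ∈ X.winSet) :
    HasDerivAt (X.gline τ) (fderiv ℝ X.D.Ψ (X.mcurve (τ, s))
      (LegendrianModel.dscurve X.ε (Real.smoothTransition τ) (sdist X.s₀ s))) s := by
  have hsd : HasDerivAt (sdist X.s₀) 1 s := hasDerivAt_sdist (X.sdist_ne_half_of_mem_winSet hs)
  have hsc := LegendrianModel.hasDerivAt_scurve X.ε_pos.ne' (Real.smoothTransition τ) (sdist X.s₀ s)
  have hcomp : HasDerivAt (fun s' => LegendrianModel.scurve X.ε (Real.smoothTransition τ) (sdist X.s₀ s'))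
      (LegendrianModel.dscurve X.ε (Real.smoothTransition τ) (sdist X.s₀ s)) s := by
    have := hsc.scomp s hsd
    rwa [one_smul] at this
  have hΨ : HasFDerivAt X.D.Ψ (fderiv ℝ X.D.Ψ (X.mcurve (τ, s))) (X.mcurve (τ, s)) :=
    (X.D.contDiffAt_Ψ (X.box_subset_V (X.mcurve_mem_box (q := (τ, s)) hs))).differentiableAt
      (by simp) |>.hasFDerivAt
  exact hΨ.comp_hasDerivAt s hcomp

/-- The model map of a stage has nonvanishing derivative at window parameters. [folklore] -/
theorem deriv_gline_ne_zero {τ s : ℝ} (hs : s ∈ X.winSet) : deriv (X.gline τ) s ≠ 0 := by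
  rw [(X.hasDerivAt_gline hs).deriv]
  intro h
  have hinj := X.D.fderiv_Ψ_injective (X.box_subset_V (X.mcurve_mem_box (q := (τ, s)) hs))
  have h0 : fderiv ℝ X.D.Ψ (X.mcurve (τ, s)) 0 = 0 := map_zero _
  exact LegendrianModel.dscurve_ne_zero X.ε_pos.ne' (smoothTransition_mem τ) _ (hinj (h.trans h0.symm))

/-- A local angle that is a section of `circlePt` has injective differential. [folklore] -/
theorem injective_mfderiv_of_section {ang : 𝕊 1 → ℝ} {z : 𝕊 1}
    (hang : ContMDiffAt (𝓡 1) 𝓘(ℝ, ℝ) ∞ ang z) (hsec : ∀ z', circlePt (ang z') = z') :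
    Injective (mfderiv (𝓡 1) 𝓘(ℝ, ℝ) ang z) := by
  have hd : MDifferentiableAt (𝓡 1) 𝓘(ℝ, ℝ) ang z := hang.mdifferentiableAt (by simp)
  have hc : MDifferentiableAt 𝓘(ℝ, ℝ) (𝓡 1) circlePt (ang z) :=
    contMDiff_circlePt.mdifferentiableAt (by simp) |>  fun h => h
  have hcomp := mfderiv_comp z hc hd
  have hid : (circlePt ∘ ang) = id := funext hsec
  rw [hid, mfderiv_id] at hcomp
  intro v₁ v₂ hv
  have e : ∀ v, v = mfderiv 𝓘(ℝ, ℝ) (𝓡 1) circlePt (ang z) (mfderiv (𝓡 1) 𝓘(ℝ, ℝ) ang z v) := fun v => by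
    have := congrArg (fun L : TangentSpace (𝓡 1) z →L[ℝ] TangentSpace (𝓡 1) z => L v) hcomp
    simp only [ContinuousLinearMap.coe_id', id_eq] at this
    exact this
  rw [e v₁, e v₂, hv]

/-- The window part of a stage, read through a local angle, is an immersion. [folklore] -/
theorem isImmersionAtOfComplement_window {τ : ℝ} {z : 𝕊 1} (ang : 𝕊 1 → ℝ) {O : Set (𝕊 1)}
    (hO : IsOpen O) (hzO : z ∈ O) (hang : ∀ z' ∈ O, ContMDiffAt (𝓡 1) 𝓘(ℝ, ℝ) ∞ ang z')
    (hsec : ∀ z', circlePt (ang z') = z') (hknot : ∀ z', X.knot τ z' = X.G τ (ang z'))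
    (hwin : ang z ∈ X.winSet) :
    Manifold.IsImmersionAtOfComplement E3 (𝓡 1) (𝓡∂ 4) ∞ (X.knot τ) z := by
  set g : 𝕊 1 → E3 := fun z' => X.gline τ (ang z') with hg
  set U : Set (𝕊 1) := O ∩ ang ⁻¹' X.winSet with hU
  have hUo : IsOpen U := by
    have hc : ContinuousOn ang O := fun z' hz' => (hang z' hz').continuousAt.continuousWithinAt
    exact hc.isOpen_inter_preimage hO X.isOpen_winSet
  have hzU : z ∈ U := ⟨hzO, hwin⟩
  have hgU : ContMDiffOn (𝓡 1) 𝓘(ℝ, E3) ∞ g U := fun z' hz' =>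
    ((X.contDiffAt_gline hz'.2).contMDiffAt.comp z' (hang z' hz'.1)).contMDiffWithinAt
  -- injectivity of the differential
  have hinj : Injective (mfderiv (𝓡 1) 𝓘(ℝ, E3) g z) := by
    have hd : MDifferentiableAt (𝓡 1) 𝓘(ℝ, ℝ) ang z := (hang z hzO).mdifferentiableAt (by simp)
    have hgl : MDifferentiableAt 𝓘(ℝ, ℝ) 𝓘(ℝ, E3) (X.gline τ) (ang z) :=
      ((X.contDiffAt_gline hwin).differentiableAt (by simp)).mdifferentiableAt
    have hcomp : mfderiv (𝓡 1) 𝓘(ℝ, E3) g z =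
        (mfderiv 𝓘(ℝ, ℝ) 𝓘(ℝ, E3) (X.gline τ) (ang z)).comp (mfderiv (𝓡 1) 𝓘(ℝ, ℝ) ang z) :=
      mfderiv_comp z hgl hd
    rw [hcomp, mfderiv_eq_fderiv]
    intro v₁ v₂ hv
    simp only [ContinuousLinearMap.coe_comp, Function.comp_apply] at hv
    set c₁ : ℝ := (mfderiv (𝓡 1) 𝓘(ℝ, ℝ) ang z v₁ : ℝ) with hc₁
    set c₂ : ℝ := (mfderiv (𝓡 1) 𝓘(ℝ, ℝ) ang z v₂ : ℝ) with hc₂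
    have key : ∀ c : ℝ, fderiv ℝ (X.gline τ) (ang z) c = c • deriv (X.gline τ) (ang z) := by
      intro c
      rw [← fderiv_apply_one_eq_deriv, ← ContinuousLinearMap.map_smul, smul_eq_mul, mul_one]
    have hv' : c₁ • deriv (X.gline τ) (ang z) = c₂ • deriv (X.gline τ) (ang z) := by
      rw [← key, ← key]; exact hv
    have hc : c₁ = c₂ := by
      by_contra hne
      have := sub_smul c₁ c₂ (deriv (X.gline τ) (ang z))
      rw [hv', sub_self] at this
      rcases smul_eq_zero.1 this with h | h
      · exact hne (sub_eq_zero.1 h)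
      · exact X.deriv_gline_ne_zero hwin h
    exact injective_mfderiv_of_section (hang z hzO) hsec hc
  -- membership and the local formula
  have hnear : ∀ᶠ z' in 𝓝 z, ang z' ∈ X.winSet :=
    (hang z hzO).continuousAt.preimage_mem_nhds (X.isOpen_winSet.mem_nhds hwin)
  have hmem : ∀ᶠ z' in 𝓝 z, X.chart X.p + L3 (g z') ∈ (extChartAt (𝓡∂ 4) X.p).target := by
    filter_upwards [hnear] with z' hz'
    exact X.emb_Ψ_mem_target (X.box_subset_V (X.mcurve_mem_box (q := (τ, ang z')) hz'))
  have hf : X.knot τ =ᶠ[𝓝 z] fun z' => (extChartAt (𝓡∂ 4) X.p).symm (X.chart X.p + L3 (g z')) := by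
    filter_upwards [hnear] with z' hz'
    rw [hknot, X.G_eq_of_mem_winSet hz']
    rfl
  exact isImmersionAtOfComplement_through_chart_of_injective_mfderiv X.chart_p_zero hUo hzU hgU hinj
    hmem hf

/-- **Every stage is an immersion.** [folklore] -/
theorem isImmersionAtOfComplement_knot (τ : ℝ) (z : 𝕊 1) :
    Manifold.IsImmersionAtOfComplement E3 (𝓡 1) (𝓡∂ 4) ∞ (X.knot τ) z := by
  have hK := isImmersionAtOfComplement_euclidean_of_isSmoothEmbedding X.legendrian.isSmoothEmbedding z
  by_cases hA : z = ptA
  · -- read through `angB`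
    subst hA
    rcases X.mem_winSet_or_farSet (angB ptA) with hw | hf
    · exact X.isImmersionAtOfComplement_window angB (isOpen_compl_singleton (x := ptB))
        ptA_ne_ptB (fun z' hz' => contMDiffAt_angB hz') circlePt_angB (X.knot_eq_G_angB τ) hw
    · exact hK.congr_of_eventuallyEq (X.knot_eventuallyEq_of_mem_farSet' hf ptA_ne_ptB).symm
  · rcases X.mem_winSet_or_farSet (angA z) with hw | hf
    · exact X.isImmersionAtOfComplement_window angA (isOpen_compl_singleton (x := ptA)) hA
        (fun z' hz' => contMDiffAt_angA hz') circlePt_angA (fun z' => rfl) hw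
    · exact hK.congr_of_eventuallyEq (X.knot_eventuallyEq_of_mem_farSet hf hA).symm

/-- **Every stage is a smooth embedding.** [folklore] -/
theorem isSmoothEmbedding_knot (τ : ℝ) : Manifold.IsSmoothEmbedding (𝓡 1) (𝓡∂ 4) ∞ (X.knot τ) :=
  ⟨⟨E3, inferInstance, inferInstance, fun z => X.isImmersionAtOfComplement_knot τ z⟩,
    ((X.contMDiff_knot τ).continuous.isClosedEmbedding (X.knot_injective τ)).isEmbedding⟩

/-- **The stabilising isotopy** from `K` to the stabilised knot `K₁ = knot 1`. [folklore] -/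
def isotopy : KnotIsotopyInBoundary X.K (X.knot 1) where
  toFun := X.knot
  contMDiff := X.contMDiff_knot_uncurry
  isSmoothEmbedding := X.isSmoothEmbedding_knot
  map_zero := X.knot_zero
  map_one := rfl
  isBoundaryPoint := fun t _ z => X.isBoundaryPoint_knot t z

/-- Stages of the stabilising isotopy. [folklore] -/
@[simp] theorem isotopy_toFun : X.isotopy.toFun = X.knot := rfl


/-! ### The stabilised knot is Legendrian -/

omit [IsManifold (𝓡∂ 4) ∞ W] [CompactSpace W] [T2Space W] in
/-- **A knot in the boundary whose velocity lies in `ξ` is Legendrian** (every tangent vector of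
the circle is a multiple of `d circlePt/dt`). [folklore] -/
theorem _root_.Literature.Geometry.Symplectic.isLegendrianKnot_of_knotVelocity_mem
    {J : (x : W) → (E4 →L[ℝ] E4)} {K : 𝕊 1 → W}
    (hK : Manifold.IsSmoothEmbedding (𝓡 1) (𝓡∂ 4) ∞ K) (hb : ∀ u, (𝓡∂ 4).IsBoundaryPoint (K u))
    (hv : ∀ t : ℝ, knotVelocity K t ∈ contactPlane J (K (circlePt t))) : IsLegendrianKnot J K where
  isSmoothEmbedding := hK
  isBoundaryPoint := hb
  mfderiv_mem u w := by
    obtain ⟨t, rfl⟩ : ∃ t, circlePt t = u := ⟨angA u, circlePt_angA u⟩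
    set e : EuclideanSpace ℝ (Fin 1) := mfderiv 𝓘(ℝ, ℝ) (𝓡 1) circlePt t (1 : ℝ) with he
    set w' : EuclideanSpace ℝ (Fin 1) := w with hw'
    have he0 : e ≠ 0 := by
      intro h0
      have h1 : mfderiv 𝓘(ℝ, ℝ) (𝓡 1) circlePt t (1 : ℝ) = mfderiv 𝓘(ℝ, ℝ) (𝓡 1) circlePt t (0 : ℝ) :=
        h0.trans (map_zero _).symm
      have h2 : (1 : ℝ) = 0 := mfderiv_circlePt_injective t h1
      exact one_ne_zero h2
    obtain ⟨c, hc⟩ : ∃ c : ℝ, c • e = w' :=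
      (finrank_eq_one_iff_of_nonzero' e he0).1 finrank_euclideanSpace_fin w'
    have hd : MDifferentiableAt (𝓡 1) (𝓡∂ 4) K (circlePt t) :=
      hK.contMDiff.mdifferentiableAt (by simp)
    set L : EuclideanSpace ℝ (Fin 1) →L[ℝ] E4 := mfderiv (𝓡 1) (𝓡∂ 4) K (circlePt t) with hL
    have hLe : L e = knotVelocity K t := (knotVelocity_eq hd).symm
    have hw : L w' = c • knotVelocity K t := by rw [← hc, L.map_smul, hLe]
    show L w' ∈ _
    rw [hw]
    exact Submodule.smul_mem _ c (hv t)

/-- **The velocity of a stage on the window, in the box frame.** [folklore] -/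
theorem knotVelocity_knot_window {τ s : ℝ} (hs : s ∈ X.winSet) :
    knotVelocity (X.knot τ) s =
      X.bv (X.mcurve (τ, s)) (LegendrianModel.dscurve X.ε (Real.smoothTransition τ) (sdist X.s₀ s)) := by
  have hh : HasDerivAt (fun t => X.emb (X.gline τ t))
      (L3 (fderiv ℝ X.D.Ψ (X.mcurve (τ, s))
        (LegendrianModel.dscurve X.ε (Real.smoothTransition τ) (sdist X.s₀ s)))) s := by
    have h := ((L3 : E3 →L[ℝ] E4).hasFDerivAt.comp_hasDerivAt s (X.hasDerivAt_gline (τ := τ) hs)).const_add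
      (X.chart X.p)
    exact h
  have hnear : ∀ᶠ t in 𝓝 s, t ∈ X.winSet := X.isOpen_winSet.mem_nhds hs
  refine X.knotVelocity_eq_M (X.contMDiff_knot τ) hh
    (X.emb_Ψ_mem_target (X.box_subset_V (X.mcurve_mem_box (q := (τ, s)) hs))) ?_ ?_
  · filter_upwards [hnear] with t ht
    rw [knot_circlePt, X.G_eq_of_mem_winSet ht]
    rfl
  · filter_upwards [hnear] with t ht
    exact X.emb_Ψ_mem_target (X.box_subset_V (X.mcurve_mem_box (q := (τ, t)) ht))

/-- On the far set the velocity of a stage is that of `K`. [folklore] -/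
theorem knotVelocity_knot_far {τ s : ℝ} (hs : s ∈ X.farSet) :
    knotVelocity (X.knot τ) s = knotVelocity X.K s := by
  have heq : (X.knot τ ∘ circlePt) =ᶠ[𝓝 s] (X.K ∘ circlePt) := by
    filter_upwards [X.isOpen_farSet.mem_nhds hs] with t ht
    simp only [Function.comp_apply, knot_circlePt, X.G_eq_of_mem_farSet ht]
  unfold knotVelocity
  rw [heq.mfderiv_eq]
  rfl

/-- The model point of the final stage. [folklore] -/
theorem mcurve_one (s : ℝ) : X.mcurve (1, s) = LegendrianModel.scurve X.ε 1 (sdist X.s₀ s) := by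
  simp [mcurve, Real.smoothTransition.one]

/-- **The velocity of the stabilised knot lies in `ξ`.** [folklore] -/
theorem knotVelocity_knot_one_mem (s : ℝ) :
    knotVelocity (X.knot 1) s ∈ contactPlane S.J (X.knot 1 (circlePt s)) := by
  rcases X.mem_winSet_or_farSet s with hs | hs
  · have hw : X.mcurve (1, s) ∈ X.D.V := X.box_subset_V (X.mcurve_mem_box (q := (1, s)) hs)
    rw [X.knotVelocity_knot_window hs, knot_circlePt, X.G_eq_of_mem_winSet hs]
    refine S.mem_contactPlane_of_contactForm_eq_zero (X.isBoundaryPoint_Wpt hw) (X.bv_apply_zero hw _) ?_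
    rw [show X.Wpt (X.mcurve (1, s)) = X.bpt (X.mcurve (1, s)) from rfl, X.contactForm_bv hw,
      Real.smoothTransition.one, mcurve_one, LegendrianModel.dscurve_one_legendrian, sub_self, mul_zero]
  · rw [X.knotVelocity_knot_far hs, knot_circlePt, X.G_eq_of_mem_farSet hs]
    exact X.legendrian.knotVelocity_mem s

/-- **The stabilised knot is Legendrian.** [cite: Gompf1998, §1] -/
theorem isLegendrianKnot_knot_one : IsLegendrianKnot S.J (X.knot 1) :=
  isLegendrianKnot_of_knotVelocity_mem (X.isSmoothEmbedding_knot 1) (X.isBoundaryPoint_knot 1)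
    X.knotVelocity_knot_one_mem


/-! ### Box coordinates of a framing of `K` along the window

The inverse of `DΨ`, the chart-`p` reading `ν̂` of a framing `ν` of `K` along the axis and its
box coordinates `nraw`, with `bv (t • e₀) (nraw t) = ν`. -/

section BoxCoords

/-- `DΨ_w` as a continuous linear equivalence (`w ∈ V`). [folklore] -/
def DΨequiv {w : E3} (hw : w ∈ X.D.V) : E3 ≃L[ℝ] E3 :=
  (LinearEquiv.ofInjectiveEndo (fderiv ℝ X.D.Ψ w).toLinearMap
    (X.D.fderiv_Ψ_injective hw)).toContinuousLinearEquiv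

/-- The equivalence `DΨ_w` is `DΨ_w`. [folklore] -/
theorem coe_DΨequiv {w : E3} (hw : w ∈ X.D.V) :
    (X.DΨequiv hw : E3 →L[ℝ] E3) = fderiv ℝ X.D.Ψ w := by
  ext v; rfl

/-- The inverse of `DΨ_w` (junk off `V`). [folklore] -/
def DΨinv (w : E3) : E3 →L[ℝ] E3 := (fderiv ℝ X.D.Ψ w).inverse

/-- On `V` the inverse of `DΨ` is the inverse equivalence. [folklore] -/
theorem DΨinv_eq {w : E3} (hw : w ∈ X.D.V) : X.DΨinv w = ((X.DΨequiv hw).symm : E3 →L[ℝ] E3) := by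
  rw [DΨinv, ← coe_DΨequiv X hw, ContinuousLinearMap.inverse_equiv]

/-- `DΨ ∘ DΨ⁻¹ = id` on `V`. [folklore] -/
theorem DΨ_DΨinv {w : E3} (hw : w ∈ X.D.V) (v : E3) : fderiv ℝ X.D.Ψ w (X.DΨinv w v) = v := by
  rw [X.DΨinv_eq hw, ← X.coe_DΨequiv hw]
  exact (X.DΨequiv hw).apply_symm_apply v

/-- `DΨ⁻¹ ∘ DΨ = id` on `V`. [folklore] -/
theorem DΨinv_DΨ {w : E3} (hw : w ∈ X.D.V) (v : E3) : X.DΨinv w (fderiv ℝ X.D.Ψ w v) = v := by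
  rw [X.DΨinv_eq hw]
  have := (X.DΨequiv hw).symm_apply_apply v
  have h2 : (X.DΨequiv hw) v = fderiv ℝ X.D.Ψ w v := by rw [← X.coe_DΨequiv hw]; rfl
  rw [h2] at this
  exact this

/-- `w ↦ DΨ_w⁻¹` is continuous on `V`. [folklore] -/
theorem continuousAt_DΨinv {w : E3} (hw : w ∈ X.D.V) : ContinuousAt X.DΨinv w := by
  have h1 : ContinuousAt (fun w => fderiv ℝ X.D.Ψ w) w :=
    ((X.D.contDiffAt_Ψ hw).fderiv_right (m := 0) (by norm_num)).continuousAt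
  have h2 : ContinuousAt ContinuousLinearMap.inverse (fderiv ℝ X.D.Ψ w) := by
    rw [← X.coe_DΨequiv hw]
    exact (contDiffAt_map_inverse (n := 0) (X.DΨequiv hw)).continuousAt
  exact h2.comp h1

/-- Axis points of the window lie in `V`. [folklore] -/
theorem axis_mem_V {t : ℝ} (ht : |t| < X.ℓ) : (t • DarbouxData.e 0 : E3) ∈ X.D.V := (X.axis_mem t ht).1

/-- `bpt (t • e₀) = K (circlePt (s₀ + t))` on the window. [folklore] -/
theorem bpt_axis {t : ℝ} (ht : |t| < X.ℓ) :
    X.bpt (t • DarbouxData.e 0) = X.K (circlePt (X.s₀ + t)) :=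
  X.Wpt_axis ht

/-- Axis points of `K` lie in the chart domain of `p`. [folklore] -/
theorem K_axis_mem_source {t : ℝ} (ht : |t| < X.ℓ) :
    X.K (circlePt (X.s₀ + t)) ∈ (chartAt (EuclideanHalfSpace 4) X.p).source := by
  rw [← X.bpt_axis ht]
  exact X.pt_mem_source (X.emb_Ψ_mem_target (X.axis_mem_V ht))

variable (ν : 𝕊 1 → E4)

/-- **The chart-`p` reading of the framing along the axis**:
`ν̂ t = tcc_{K(c(s₀+t)) → p} (ν (c (s₀ + t)))`. [folklore] -/
def νhat (t : ℝ) : E4 :=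
  tangentCoordChange (𝓡∂ 4) (X.K (circlePt (X.s₀ + t))) X.p (X.K (circlePt (X.s₀ + t)))
    (ν (circlePt (X.s₀ + t)))

/-- **The box coordinates of the framing along the axis.** [folklore] -/
def nraw (t : ℝ) : E3 := X.DΨinv (t • DarbouxData.e 0) (proj3 (X.νhat ν t))

variable {ν}

/-- `M` applied to the chart-`p` reading returns the framing vector. [folklore] -/
theorem M_νhat {t : ℝ} (ht : |t| < X.ℓ) :
    X.M (X.emb (X.D.Ψ (t • DarbouxData.e 0))) (X.νhat ν t) = ν (circlePt (X.s₀ + t)) := by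
  have hy := X.emb_Ψ_mem_target (X.axis_mem_V ht)
  have h := X.M_tangentCoordChange hy (ν (circlePt (X.s₀ + t)))
  have hpt : X.pt (X.emb (X.D.Ψ (t • DarbouxData.e 0))) = X.K (circlePt (X.s₀ + t)) := X.bpt_axis ht
  rw [hpt] at h
  exact h

/-- The chart-`p` reading of a framing lies in the hyperplane. [folklore] -/
theorem νhat_apply_zero (hν : IsKnotFraming X.K ν) {t : ℝ} (ht : |t| < X.ℓ) : X.νhat ν t 0 = 0 := by
  have hy := X.emb_Ψ_mem_target (X.axis_mem_V ht)
  rw [← X.M_apply_zero_iff hy (X.emb_apply_zero _), X.M_νhat ht]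
  exact hν.mem_boundaryTangentSpace _

/-- **(P1)** The box frame applied to the box coordinates returns the framing:
`bv (t • e₀) (nraw t) = ν (c (s₀ + t))`. [folklore] -/
theorem bv_nraw (hν : IsKnotFraming X.K ν) {t : ℝ} (ht : |t| < X.ℓ) :
    X.bv (t • DarbouxData.e 0) (X.nraw ν t) = ν (circlePt (X.s₀ + t)) := by
  have hV := X.axis_mem_V ht
  rw [show X.bv (t • DarbouxData.e 0) (X.nraw ν t) =
      X.M (X.emb (X.D.Ψ (t • DarbouxData.e 0))) (L3 (fderiv ℝ X.D.Ψ (t • DarbouxData.e 0) (X.nraw ν t)))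
    from rfl, nraw, X.DΨ_DΨinv hV, L3_proj3 (X.νhat_apply_zero hν ht), X.M_νhat ht]

/-- The velocity of `K` on the window in the box frame: `ċ(s₀ + t) = bv (t • e₀) e₀`. [folklore] -/
theorem knotVelocity_K_axis {t : ℝ} (ht : |t| < X.ℓ) :
    knotVelocity X.K (X.s₀ + t) = X.bv (t • DarbouxData.e 0) (DarbouxData.e 0) := by
  have hV := X.axis_mem_V ht
  have hopen : ∀ᶠ t' in 𝓝 (X.s₀ + t), |t' - X.s₀| < X.ℓ := by
    have hc : Continuous fun t' : ℝ => |t' - X.s₀| := by fun_prop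
    exact (isOpen_lt hc continuous_const).mem_nhds (by simpa using ht)
  have hline : HasDerivAt (fun t' : ℝ => (t' - X.s₀) • (DarbouxData.e 0 : E3)) (DarbouxData.e 0) (X.s₀ + t) := by
    have := ((hasDerivAt_id' (X.s₀ + t)).sub_const X.s₀).smul_const (DarbouxData.e 0 : E3)
    rwa [one_smul] at this
  have hΨ : HasFDerivAt X.D.Ψ (fderiv ℝ X.D.Ψ (t • DarbouxData.e 0)) ((X.s₀ + t - X.s₀) • DarbouxData.e 0) := by
    rw [add_sub_cancel_left]
    exact ((X.D.contDiffAt_Ψ hV).differentiableAt (by simp)).hasFDerivAt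
  have hh : HasDerivAt (fun t' : ℝ => X.emb (X.D.Ψ ((t' - X.s₀) • DarbouxData.e 0)))
      (L3 (fderiv ℝ X.D.Ψ (t • DarbouxData.e 0) (DarbouxData.e 0))) (X.s₀ + t) := by
    have h1 := hΨ.comp_hasDerivAt (X.s₀ + t) hline
    have h2 := ((L3 : E3 →L[ℝ] E4).hasFDerivAt.comp_hasDerivAt (X.s₀ + t) h1).const_add (X.chart X.p)
    exact h2
  have key := X.knotVelocity_eq_M X.legendrian.isSmoothEmbedding.contMDiff hh
    (by rw [add_sub_cancel_left]; exact X.emb_Ψ_mem_target hV) ?_ ?_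
  · rw [key, add_sub_cancel_left]; rfl
  · filter_upwards [hopen] with t' ht'
    rw [show t' = X.s₀ + (t' - X.s₀) by ring, ← X.bpt_axis ht', add_sub_cancel_left]
    rfl
  · filter_upwards [hopen] with t' ht'
    exact X.emb_Ψ_mem_target (X.axis_mem_V ht')

/-- **(P3)** The box coordinates of a framing are transverse to the axis. [folklore] -/
theorem nraw_ne_smul (hν : IsKnotFraming X.K ν) {t : ℝ} (ht : |t| < X.ℓ) (c : ℝ) :
    X.nraw ν t ≠ c • DarbouxData.e 0 := by
  intro h
  apply hν.not_mem_span (X.s₀ + t)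
  rw [← X.bv_nraw hν ht, h, X.bv_smul, X.knotVelocity_K_axis ht]
  exact Submodule.smul_mem _ c (Submodule.mem_span_singleton_self _)

/-- The chart-`p` reading of the framing is continuous on the window (trivialization of `TW` at
`p`). [folklore] -/
theorem continuousAt_νhat (hν : IsKnotFraming X.K ν) {t : ℝ} (ht : |t| < X.ℓ) :
    ContinuousAt (X.νhat ν) t := by
  set e := trivializationAt E4 (TangentSpace (𝓡∂ 4)) X.p with he
  set f : ℝ → TangentBundle (𝓡∂ 4) W := fun t' =>
    Bundle.TotalSpace.mk' E4 (X.K (circlePt (X.s₀ + t'))) (ν (circlePt (X.s₀ + t'))) with hf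
  have hfc : Continuous f := hν.continuous.comp (continuous_circlePt.comp (continuous_const.add continuous_id))
  have hsrc : f t ∈ e.source := by
    rw [e.mem_source, he, TangentBundle.trivializationAt_baseSet]
    exact X.K_axis_mem_source ht
  have h1 : ContinuousAt (e ∘ f) t :=
    (e.toOpenPartialHomeomorph.continuousAt hsrc).comp hfc.continuousAt
  have h2 : ContinuousAt (fun t' => (e (f t')).2) t := continuousAt_snd.comp h1
  have hopen : ∀ᶠ t' in 𝓝 t, |t'| < X.ℓ := (isOpen_lt continuous_abs continuous_const).mem_nhds ht
  refine h2.congr ?_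
  filter_upwards [hopen] with t' ht'
  rw [he, TangentBundle.trivializationAt_apply]
  rw [νhat, tangentCoordChange_def]
  rfl

/-- **(P2)** The box coordinates of a framing are continuous on the window. [folklore] -/
theorem continuousAt_nraw (hν : IsKnotFraming X.K ν) {t : ℝ} (ht : |t| < X.ℓ) :
    ContinuousAt (X.nraw ν) t := by
  have hl : Continuous fun t' : ℝ => (t' • DarbouxData.e 0 : E3) := continuous_id.smul continuous_const
  have h1 : ContinuousAt (fun t' : ℝ => X.DΨinv (t' • DarbouxData.e 0)) t :=
    ContinuousAt.comp (f := fun t' : ℝ => (t' • DarbouxData.e 0 : E3)) (X.continuousAt_DΨinv (X.axis_mem_V ht))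
      hl.continuousAt
  have h2 : ContinuousAt (fun t' => proj3 (X.νhat ν t')) t :=
    proj3.continuous.continuousAt.comp (X.continuousAt_νhat hν ht)
  exact h1.clm_apply h2

/-- **The box frame is continuous into `TW`** (trivialization at `p`: the frame vector `bv w ξ`
reads `L3 (DΨ_w ξ)`). [folklore] -/
theorem continuousAt_boxFrame {P : Type*} [TopologicalSpace P] {wf : P → E3} {ξf : P → E3} {q : P}
    (hwf : ContinuousAt wf q) (hξf : ContinuousAt ξf q) (hq : wf q ∈ X.D.V) :
    ContinuousAt (fun q' => (Bundle.TotalSpace.mk' E4 (X.bpt (wf q')) (X.bv (wf q') (ξf q')) :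
      TangentBundle (𝓡∂ 4) W)) q := by
  set e := trivializationAt E4 (TangentSpace (𝓡∂ 4)) X.p with he
  have hnear : ∀ᶠ q' in 𝓝 q, wf q' ∈ X.D.V := hwf.preimage_mem_nhds (X.D.isOpen_V.mem_nhds hq)
  refine e.continuousAt_of_comp_left ?_ ?_ ?_
  · -- the base point
    have : ContinuousAt (fun q' => X.bpt (wf q')) q := by
      have h := X.contMDiffAt_Wpt_comp (IP := 𝓘(ℝ, E3)) (h := id) (q := wf q) contMDiffAt_id hq
      exact h.continuousAt.comp hwf
    exact this
  · rw [he, TangentBundle.trivializationAt_baseSet]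
    exact X.pt_mem_source (X.emb_Ψ_mem_target hq)
  · have hformula : ∀ᶠ q' in 𝓝 q, (e ∘ fun q' => (Bundle.TotalSpace.mk' E4 (X.bpt (wf q'))
        (X.bv (wf q') (ξf q')) : TangentBundle (𝓡∂ 4) W)) q' =
        (X.bpt (wf q'), L3 (fderiv ℝ X.D.Ψ (wf q') (ξf q'))) := by
      filter_upwards [hnear] with q' hq'
      rw [Function.comp_apply, he, TangentBundle.trivializationAt_apply]
      refine Prod.ext rfl ?_
      have := X.tangentCoordChange_bv hq' (ξf q')
      rw [tangentCoordChange_def] at this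
      exact this
    refine (ContinuousAt.congr ?_ (hformula.mono fun q' h => h.symm))
    refine ContinuousAt.prodMk ?_ ?_
    · have h := X.contMDiffAt_Wpt_comp (IP := 𝓘(ℝ, E3)) (h := id) (q := wf q) contMDiffAt_id hq
      exact h.continuousAt.comp hwf
    · refine L3.continuous.continuousAt.comp ?_
      have hD : ContinuousAt (fun q' => fderiv ℝ X.D.Ψ (wf q')) q :=
        ((X.D.contDiffAt_Ψ hq).fderiv_right (m := 0) (by norm_num)).continuousAt.comp hwf
      exact hD.clm_apply hξf

end BoxCoords


/-! ### Far sets with a general margin -/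

section FarR

/-- The parameters at signed distance more than `a` from `s₀` (an open set). [folklore] -/
def farSetR (a : ℝ) : Set ℝ := {s | ∃ m : ℤ, s - X.s₀ - m ∈ Ioo a (1 - a)}

/-- The far set with margin `a` is open. [folklore] -/
theorem isOpen_farSetR (a : ℝ) : IsOpen (X.farSetR a) := by
  have : X.farSetR a = ⋃ m : ℤ, (fun s => s - X.s₀ - m) ⁻¹' Ioo a (1 - a) := by
    ext s; simp [farSetR]
  rw [this]
  exact isOpen_iUnion fun m => isOpen_Ioo.preimage (by fun_prop)

/-- On the far set with margin `a`, `a < |sdist|`. [folklore] -/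
theorem lt_abs_sdist_of_mem_farSetR {a s : ℝ} (hs : s ∈ X.farSetR a) : a < |sdist X.s₀ s| := by
  obtain ⟨m, hm1, hm2⟩ := hs
  obtain ⟨k, hk⟩ := exists_int_eq_add_sdist X.s₀ s
  have hmem := sdist_mem X.s₀ s
  -- `s - s₀ - m` and `sdist` differ by the integer `k - m`
  have hdiff : s - X.s₀ - m = sdist X.s₀ s + (k - m : ℤ) := by push_cast; linarith
  rw [hdiff] at hm1 hm2
  rcases lt_trichotomy (k - m : ℤ) 0 with hlt | heq | hgt
  · have : ((k - m : ℤ) : ℝ) ≤ -1 := by exact_mod_cast Int.le_sub_one_iff.2 hlt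
    linarith [hmem.2, abs_nonneg (sdist X.s₀ s)]
  · rw [heq] at hm1; push_cast at hm1
    rw [add_zero] at hm1
    exact lt_of_lt_of_le hm1 (le_abs_self _)
  · have : (1 : ℝ) ≤ ((k - m : ℤ) : ℝ) := by exact_mod_cast hgt
    have : sdist X.s₀ s < -a := by linarith
    exact lt_of_lt_of_le (by linarith) (neg_le_abs _)

/-- Parameters with `a < |sdist|` lie in the far set with margin `a`. [folklore] -/
theorem mem_farSetR_of_lt {a s : ℝ} (hs : a < |sdist X.s₀ s|) : s ∈ X.farSetR a := by
  obtain ⟨m, hm⟩ := exists_int_eq_add_sdist X.s₀ s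
  have hmem := sdist_mem X.s₀ s
  rcases le_or_gt 0 (sdist X.s₀ s) with hpos | hneg
  · rw [abs_of_nonneg hpos] at hs
    exact ⟨m, by rw [show s - X.s₀ - m = sdist X.s₀ s by linarith]; exact ⟨hs, by linarith [hmem.2]⟩⟩
  · rw [abs_of_neg hneg] at hs
    exact ⟨m - 1, by
      rw [show s - X.s₀ - ((m - 1 : ℤ) : ℝ) = sdist X.s₀ s + 1 by push_cast; linarith]
      exact ⟨by linarith [hmem.1], by linarith⟩⟩

/-- Parameters off the window lie in the far set. [folklore] -/
theorem mem_farSet_of_le {s : ℝ} (hs : X.w₀ ≤ |sdist X.s₀ s|) : s ∈ X.farSet := by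
  rcases X.mem_winSet_or_farSet s with h | h
  · exact absurd h (not_lt.2 hs)
  · exact h

end FarR

/-! ### Model lemmas -/

section ModelLemmas

/-- `(1, 0, 0) = e₀`. [folklore] -/
theorem e0_eq : (!₂[(1 : ℝ), 0, 0] : E3) = DarbouxData.e 0 :=
  LegendrianModel.euclidean_three_ext (by simp) (by simp [DarbouxData.e_apply])
    (by simp [DarbouxData.e_apply])

/-- `e_z = e₂`. [folklore] -/
theorem ez_eq : LegendrianModel.ez = (DarbouxData.e 2 : E3) :=
  LegendrianModel.euclidean_three_ext (by simp [LegendrianModel.ez, DarbouxData.e_apply])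
    (by simp [LegendrianModel.ez, DarbouxData.e_apply]) (by simp [LegendrianModel.ez])

/-- Off the core the velocity of every model stage is `e₀`. [folklore] -/
theorem dscurve_eq_e0 {ε τ t : ℝ} (hε : 0 < ε) (ht : 4 * ε ≤ |t|) :
    LegendrianModel.dscurve ε τ t = DarbouxData.e 0 := by
  have h : 4 ≤ |t / ε| := by
    rw [abs_div, abs_of_pos hε, le_div_iff₀ hε]; exact ht
  rw [LegendrianModel.dscurve, LegendrianModel.dcurve_eq h, ← e0_eq]
  exact LegendrianModel.euclidean_three_ext (by simp) (by simp) (by simp)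

/-- The velocity of the model stage `τ = 0` (the axis) is `e₀`. [folklore] -/
theorem dscurve_zero_left (ε t : ℝ) : LegendrianModel.dscurve ε 0 t = DarbouxData.e 0 := by
  rw [LegendrianModel.dscurve, ← e0_eq]
  exact LegendrianModel.euclidean_three_ext (by simp) (by simp) (by simp)

/-- The velocity of the model stages is jointly continuous. [folklore] -/
theorem continuous_dscurve (ε : ℝ) : Continuous fun p : ℝ × ℝ => LegendrianModel.dscurve ε p.1 p.2 := by
  have h0 : Continuous fun p : ℝ × ℝ => LegendrianModel.dcurve p.1 (p.2 / ε) 0 := by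
    simp only [LegendrianModel.dcurve_apply_zero]
    exact continuous_const.add (continuous_fst.mul
      ((LegendrianModel.continuous_xd.comp (continuous_snd.div_const ε)).sub continuous_const))
  have h1 : Continuous fun p : ℝ × ℝ => LegendrianModel.dcurve p.1 (p.2 / ε) 1 := by
    simp only [LegendrianModel.dcurve_apply_one]
    exact continuous_fst.mul (LegendrianModel.continuous_dY.comp (continuous_snd.div_const ε))
  have h2 : Continuous fun p : ℝ × ℝ => LegendrianModel.dcurve p.1 (p.2 / ε) 2 := by
    simp only [LegendrianModel.dcurve_apply_two]
    exact continuous_fst.mul ((LegendrianModel.continuous_Y.comp (continuous_snd.div_const ε)).mul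
      (LegendrianModel.continuous_xd.comp (continuous_snd.div_const ε)))
  have h : Continuous fun p : ℝ × ℝ => (![LegendrianModel.dcurve p.1 (p.2 / ε) 0,
      LegendrianModel.dcurve p.1 (p.2 / ε) 1, ε * LegendrianModel.dcurve p.1 (p.2 / ε) 2] : Fin 3 → ℝ) := by
    rw [continuous_pi_iff]
    intro i; fin_cases i
    · exact h0
    · exact h1
    · exact continuous_const.mul h2
  exact (EuclideanSpace.equiv (Fin 3) ℝ).symm.continuous.comp h

end ModelLemmas

/-! ### The framing family: phases in box coordinates -/

section Phases

/-- Clamp to `[0, 1]`. [folklore] -/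
def cl (x : ℝ) : ℝ := max 0 (min 1 x)

/-- The clamp is continuous. [folklore] -/
theorem continuous_cl : Continuous cl := continuous_const.max (continuous_const.min continuous_id)

/-- The clamp takes values in `[0, 1]`. [folklore] -/
theorem cl_mem (x : ℝ) : cl x ∈ Icc (0 : ℝ) 1 :=
  ⟨le_max_left _ _, max_le zero_le_one (min_le_left _ _)⟩

/-- The clamp of a nonpositive number is `0`. [folklore] -/
theorem cl_of_nonpos {x : ℝ} (hx : x ≤ 0) : cl x = 0 := by
  unfold cl; rw [max_eq_left]; exact le_trans (min_le_right _ _) hx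

/-- The clamp of a number `≥ 1` is `1`. [folklore] -/
theorem cl_of_one_le {x : ℝ} (hx : 1 ≤ x) : cl x = 1 := by
  unfold cl; rw [min_eq_left hx, max_eq_right zero_le_one]

/-- The clamp is the identity on `[0, 1]`. [folklore] -/
theorem cl_of_mem {x : ℝ} (hx : x ∈ Icc (0 : ℝ) 1) : cl x = x := by
  unfold cl; rw [min_eq_right hx.2, max_eq_right hx.1]

/-- `cl 0 = 0`. [folklore] -/
@[simp] theorem cl_zero : cl 0 = 0 := cl_of_nonpos le_rfl

/-- `cl 1 = 1`. [folklore] -/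
@[simp] theorem cl_one : cl 1 = 1 := cl_of_one_le le_rfl

variable (ν : 𝕊 1 → E4)

/-- **Clamped box coordinates of the framing** (continuous on all of `ℝ`). [folklore] -/
def nbox (t : ℝ) : E3 := X.nraw ν (max (-X.w₀) (min X.w₀ t))

/-- The cut-off `ψ`: `1` on `|t| ≤ 8ε`, `0` on `|t| ≥ 12ε`. [folklore] -/
def ψ (t : ℝ) : ℝ := cl (3 - |t| / (4 * X.ε))

/-- The cut-off `χ`: `1` on `|t| ≤ 4ε`, `0` on `|t| ≥ 8ε`. [folklore] -/
def χ (t : ℝ) : ℝ := cl (2 - |t| / (4 * X.ε))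

/-- **Phase 0a** (reparametrisation): `n₁ σ t = n (t (1 - σ ψ t))`. [folklore] -/
def n₁ (σ t : ℝ) : E3 := X.nbox ν (t * (1 - cl σ * X.ψ t))

/-- The complex number `c + b i` of the components `(b, c) = (n₁(0), n₂(0))` of `n(0)`. [folklore] -/
def ζ0 : ℂ := ⟨X.nbox ν 0 2, X.nbox ν 0 1⟩

/-- The complex path `exp ((1 - s) log ζ₀)` from `ζ₀` to `1`. [folklore] -/
def ζpath (s : ℝ) : ℂ := Complex.exp ((1 - s : ℝ) * Complex.log (X.ζ0 ν))

/-- **The path of constant vectors** from `n(0)` (`s = 0`) to `e₂` (`s = 1`). [folklore] -/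
def Pvec (s : ℝ) : E3 := !₂[(1 - s) * X.nbox ν 0 0, (X.ζpath ν s).im, (X.ζpath ν s).re]

/-- **Phase 0a''** (straightening the constant vector to `e₂` on `|t| ≤ 4ε`). [folklore] -/
def n₂ (σ t : ℝ) : E3 := if |t| ≤ 8 * X.ε then X.Pvec ν (cl σ * X.χ t) else X.n₁ ν 1 t

/-- **Phase 0b** (rotating `e₂` into the model framing `fr`). [folklore] -/
def n₃ (σ t : ℝ) : E3 :=
  if |t| ≤ 4 * X.ε then LegendrianModel.frh (cl σ) (t / X.ε) else X.n₂ ν 1 t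

/-- **The box coordinates of the framing family** along the isotopy time `r`. [folklore] -/
def mf (r t : ℝ) : E3 :=
  if r ≤ 1 / 6 then X.n₁ ν (6 * r) t else if r ≤ 2 / 6 then X.n₂ ν (6 * r - 1) t else X.n₃ ν (6 * r - 2) t

variable {ν}

/-- The window clamp takes values in `[-w₀, w₀]`. [folklore] -/
theorem abs_clampW_le (t : ℝ) : |max (-X.w₀) (min X.w₀ t)| ≤ X.w₀ :=
  abs_le.2 ⟨le_max_left _ _, max_le (by linarith [X.w₀_pos]) (min_le_left _ _)⟩

/-- The window clamp takes values in the box. [folklore] -/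
theorem abs_clampW_lt_ℓ (t : ℝ) : |max (-X.w₀) (min X.w₀ t)| < X.ℓ :=
  lt_of_le_of_lt (X.abs_clampW_le t) X.w₀_lt_ℓ

/-- On `[-w₀, w₀]` the clamped box coordinates are the box coordinates. [folklore] -/
theorem nbox_eq {t : ℝ} (ht : |t| ≤ X.w₀) : X.nbox ν t = X.nraw ν t := by
  rw [nbox, min_eq_right (abs_le.1 ht).2, max_eq_right (abs_le.1 ht).1]

/-- The clamped box coordinates are continuous. [folklore] -/
theorem continuous_nbox (hν : IsKnotFraming X.K ν) : Continuous (X.nbox ν) := by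
  have hc : Continuous fun t : ℝ => max (-X.w₀) (min X.w₀ t) :=
    continuous_const.max (continuous_const.min continuous_id)
  exact continuous_iff_continuousAt.2 fun t =>
    ContinuousAt.comp (f := fun t : ℝ => max (-X.w₀) (min X.w₀ t)) (X.continuousAt_nraw hν (X.abs_clampW_lt_ℓ t))
      hc.continuousAt

/-- The clamped box coordinates are transverse to the axis. [folklore] -/
theorem nbox_ne_smul (hν : IsKnotFraming X.K ν) (t c : ℝ) : X.nbox ν t ≠ c • DarbouxData.e 0 :=
  X.nraw_ne_smul hν (X.abs_clampW_lt_ℓ t) c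

/-- `ψ` is continuous. [folklore] -/
theorem continuous_ψ : Continuous X.ψ :=
  continuous_cl.comp (continuous_const.sub (continuous_abs.div_const _))

/-- `χ` is continuous. [folklore] -/
theorem continuous_χ : Continuous X.χ :=
  continuous_cl.comp (continuous_const.sub (continuous_abs.div_const _))

/-- `ψ = 1` on `|t| ≤ 8ε`. [folklore] -/
theorem ψ_of_le {t : ℝ} (ht : |t| ≤ 8 * X.ε) : X.ψ t = 1 := by
  apply cl_of_one_le
  have hε := X.ε_pos
  have : |t| / (4 * X.ε) ≤ 2 := by rw [div_le_iff₀ (by linarith)]; linarith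
  linarith

/-- `ψ = 0` on `|t| ≥ 12ε`. [folklore] -/
theorem ψ_of_ge {t : ℝ} (ht : 12 * X.ε ≤ |t|) : X.ψ t = 0 := by
  apply cl_of_nonpos
  have hε := X.ε_pos
  have : 3 ≤ |t| / (4 * X.ε) := by rw [le_div_iff₀ (by linarith)]; linarith
  linarith

/-- `χ = 1` on `|t| ≤ 4ε`. [folklore] -/
theorem χ_of_le {t : ℝ} (ht : |t| ≤ 4 * X.ε) : X.χ t = 1 := by
  apply cl_of_one_le
  have hε := X.ε_pos
  have : |t| / (4 * X.ε) ≤ 1 := by rw [div_le_iff₀ (by linarith)]; linarith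
  linarith

/-- `χ = 0` on `|t| ≥ 8ε`. [folklore] -/
theorem χ_of_ge {t : ℝ} (ht : 8 * X.ε ≤ |t|) : X.χ t = 0 := by
  apply cl_of_nonpos
  have hε := X.ε_pos
  have : 2 ≤ |t| / (4 * X.ε) := by rw [le_div_iff₀ (by linarith)]; linarith
  linarith

/-! Phase 0a. -/

/-- Phase 0a starts at the box coordinates of `ν`. [folklore] -/
theorem n₁_zero (t : ℝ) : X.n₁ ν 0 t = X.nbox ν t := by simp [n₁]

/-- Phase 0a does not move `|t| ≥ 12ε`. [folklore] -/
theorem n₁_of_ge {t : ℝ} (ht : 12 * X.ε ≤ |t|) (σ : ℝ) : X.n₁ ν σ t = X.nbox ν t := by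
  simp [n₁, X.ψ_of_ge ht]

/-- At the end of phase 0a the box coordinates are constant on `|t| ≤ 8ε`. [folklore] -/
theorem n₁_of_le {σ t : ℝ} (hσ : 1 ≤ σ) (ht : |t| ≤ 8 * X.ε) : X.n₁ ν σ t = X.nbox ν 0 := by
  simp [n₁, X.ψ_of_le ht, cl_of_one_le hσ]

/-- Phase 0a is jointly continuous. [folklore] -/
theorem continuous_n₁ (hν : IsKnotFraming X.K ν) : Continuous fun q : ℝ × ℝ => X.n₁ ν q.1 q.2 :=
  (X.continuous_nbox hν).comp (continuous_snd.mul (continuous_const.sub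
    ((continuous_cl.comp continuous_fst).mul (X.continuous_ψ.comp continuous_snd))))

/-- Phase 0a stays transverse to the axis. [folklore] -/
theorem n₁_ne_smul (hν : IsKnotFraming X.K ν) (σ t c : ℝ) : X.n₁ ν σ t ≠ c • DarbouxData.e 0 :=
  X.nbox_ne_smul hν _ c

/-! The path of constant vectors. -/

/-- `ζ₀ ≠ 0` (the framing is transverse to the axis at the base point). [folklore] -/
theorem ζ0_ne_zero (hν : IsKnotFraming X.K ν) : X.ζ0 ν ≠ 0 := by
  intro h
  have h1 : X.nbox ν 0 1 = 0 := by simpa [ζ0] using congrArg Complex.im h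
  have h2 : X.nbox ν 0 2 = 0 := by simpa [ζ0] using congrArg Complex.re h
  apply X.nbox_ne_smul hν 0 (X.nbox ν 0 0)
  exact LegendrianModel.euclidean_three_ext (by simp) (by simp [DarbouxData.e_apply, h1])
    (by simp [DarbouxData.e_apply, h2])

/-- The complex path is continuous. [folklore] -/
theorem continuous_ζpath : Continuous (X.ζpath ν) :=
  Complex.continuous_exp.comp ((Complex.continuous_ofReal.comp (continuous_const.sub continuous_id)).mul
    continuous_const)

/-- The complex path avoids `0`. [folklore] -/
theorem ζpath_ne_zero (s : ℝ) : X.ζpath ν s ≠ 0 := Complex.exp_ne_zero _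

/-- The complex path starts at `ζ₀`. [folklore] -/
theorem ζpath_zero (hν : IsKnotFraming X.K ν) : X.ζpath ν 0 = X.ζ0 ν := by
  simp [ζpath, Complex.exp_log (X.ζ0_ne_zero hν)]

/-- The complex path ends at `1`. [folklore] -/
theorem ζpath_one : X.ζpath ν 1 = 1 := by simp [ζpath]

/-- The path of constant vectors is continuous. [folklore] -/
theorem continuous_Pvec : Continuous (X.Pvec ν) := by
  have h : Continuous fun s : ℝ => (![(1 - s) * X.nbox ν 0 0, (X.ζpath ν s).im, (X.ζpath ν s).re] : Fin 3 → ℝ) := by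
    rw [continuous_pi_iff]
    intro i; fin_cases i
    · exact (continuous_const.sub continuous_id).mul continuous_const
    · exact Complex.continuous_im.comp X.continuous_ζpath
    · exact Complex.continuous_re.comp X.continuous_ζpath
  exact (EuclideanSpace.equiv (Fin 3) ℝ).symm.continuous.comp h

/-- The path of constant vectors starts at `n(0)`. [folklore] -/
theorem Pvec_zero (hν : IsKnotFraming X.K ν) : X.Pvec ν 0 = X.nbox ν 0 :=
  LegendrianModel.euclidean_three_ext (by simp [Pvec]) (by simp [Pvec, X.ζpath_zero hν, ζ0])
    (by simp [Pvec, X.ζpath_zero hν, ζ0])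

/-- The path of constant vectors ends at `e₂`. [folklore] -/
theorem Pvec_one : X.Pvec ν 1 = LegendrianModel.ez :=
  LegendrianModel.euclidean_three_ext (by simp [Pvec, LegendrianModel.ez])
    (by simp [Pvec, ζpath_one, LegendrianModel.ez]) (by simp [Pvec, ζpath_one, LegendrianModel.ez])

/-- The path of constant vectors stays transverse to the axis. [folklore] -/
theorem Pvec_ne_smul (s c : ℝ) : X.Pvec ν s ≠ c • DarbouxData.e 0 := by
  intro h
  have h1 : (X.ζpath ν s).im = 0 := by
    simpa [Pvec, DarbouxData.e_apply] using congrArg (fun v : E3 => v 1) h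
  have h2 : (X.ζpath ν s).re = 0 := by
    simpa [Pvec, DarbouxData.e_apply] using congrArg (fun v : E3 => v 2) h
  exact X.ζpath_ne_zero s (Complex.ext h2 h1)

/-! Phase 0a''. -/

/-- Phase 0a'' starts at the end of phase 0a. [folklore] -/
theorem n₂_zero (hν : IsKnotFraming X.K ν) (t : ℝ) : X.n₂ ν 0 t = X.n₁ ν 1 t := by
  unfold n₂
  split_ifs with h
  · rw [cl_zero, zero_mul, X.Pvec_zero hν, X.n₁_of_le le_rfl h]
  · rfl

/-- Phase 0a'' does not move `|t| > 8ε`. [folklore] -/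
theorem n₂_of_lt {t : ℝ} (ht : 8 * X.ε < |t|) (σ : ℝ) : X.n₂ ν σ t = X.n₁ ν 1 t := by
  simp [n₂, not_le.2 ht]

/-- At the end of phase 0a'' the box coordinates are `e₂` on `|t| ≤ 4ε`. [folklore] -/
theorem n₂_of_le {σ t : ℝ} (hσ : 1 ≤ σ) (ht : |t| ≤ 4 * X.ε) : X.n₂ ν σ t = LegendrianModel.ez := by
  have h8 : |t| ≤ 8 * X.ε := by linarith [X.ε_pos]
  simp [n₂, h8, cl_of_one_le hσ, X.χ_of_le ht, Pvec_one]

/-- Phase 0a'' is jointly continuous. [folklore] -/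
theorem continuous_n₂ (hν : IsKnotFraming X.K ν) : Continuous fun q : ℝ × ℝ => X.n₂ ν q.1 q.2 := by
  refine Continuous.if_le ?_ ?_ (continuous_abs.comp continuous_snd) continuous_const ?_
  · exact X.continuous_Pvec.comp ((continuous_cl.comp continuous_fst).mul (X.continuous_χ.comp continuous_snd))
  · exact (X.continuous_n₁ hν).comp (continuous_const.prodMk continuous_snd)
  · rintro ⟨σ, t⟩ h
    simp only at h ⊢
    rw [X.χ_of_ge h.ge, mul_zero, X.Pvec_zero hν, X.n₁_of_le le_rfl h.le]

/-- Phase 0a'' stays transverse to the axis. [folklore] -/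
theorem n₂_ne_smul (hν : IsKnotFraming X.K ν) (σ t c : ℝ) : X.n₂ ν σ t ≠ c • DarbouxData.e 0 := by
  unfold n₂; split_ifs
  · exact X.Pvec_ne_smul _ c
  · exact X.n₁_ne_smul hν 1 t c

/-! Phase 0b. -/

/-- Phase 0b starts at the end of phase 0a''. [folklore] -/
theorem n₃_zero (t : ℝ) : X.n₃ ν 0 t = X.n₂ ν 1 t := by
  unfold n₃
  split_ifs with h
  · rw [cl_zero, LegendrianModel.frh_zero_left, X.n₂_of_le le_rfl h]
  · rfl

/-- Phase 0b does not move `|t| > 4ε`. [folklore] -/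
theorem n₃_of_lt {t : ℝ} (ht : 4 * X.ε < |t|) (σ : ℝ) : X.n₃ ν σ t = X.n₂ ν 1 t := by
  simp [n₃, not_le.2 ht]

/-- At the end of phase 0b the box coordinates are the model framing `fr (t/ε)` on `|t| ≤ 4ε`. [folklore] -/
theorem n₃_of_le {σ t : ℝ} (hσ : 1 ≤ σ) (ht : |t| ≤ 4 * X.ε) :
    X.n₃ ν σ t = LegendrianModel.fr (t / X.ε) := by
  rw [n₃, if_pos ht, cl_of_one_le hσ, LegendrianModel.frh_one_left]

/-- Phase 0b is jointly continuous. [folklore] -/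
theorem continuous_n₃ (hν : IsKnotFraming X.K ν) : Continuous fun q : ℝ × ℝ => X.n₃ ν q.1 q.2 := by
  have hg : Continuous fun q : ℝ × ℝ => (cl q.1, q.2 / X.ε) :=
    (continuous_cl.comp continuous_fst).prodMk (continuous_snd.div_const X.ε)
  have hA := LegendrianModel.continuous_frh.comp hg
  have hB : Continuous fun q : ℝ × ℝ => X.n₂ ν 1 q.2 :=
    (X.continuous_n₂ hν).comp (continuous_const.prodMk continuous_snd)
  have hagree : ∀ q : ℝ × ℝ, |q.2| = 4 * X.ε →
      LegendrianModel.frh (cl q.1) (q.2 / X.ε) = X.n₂ ν 1 q.2 := by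
    rintro ⟨σ, t⟩ (h : |t| = 4 * X.ε)
    have hε := X.ε_pos
    have h2 : 2 ≤ |t / X.ε| := by
      rw [abs_div, abs_of_pos X.ε_pos, le_div_iff₀ X.ε_pos]; linarith
    show LegendrianModel.frh (cl σ) (t / X.ε) = X.n₂ ν 1 t
    rw [LegendrianModel.frh_of_two_le _ h2, X.n₂_of_le le_rfl h.le]
  exact Continuous.if_le hA hB (continuous_abs.comp continuous_snd) continuous_const hagree

/-- Phase 0b stays transverse to the axis. [folklore] -/
theorem n₃_ne_smul (hν : IsKnotFraming X.K ν) (σ t c : ℝ) : X.n₃ ν σ t ≠ c • DarbouxData.e 0 := by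
  unfold n₃; split_ifs
  · exact LegendrianModel.frh_ne_smul _ _ c (by simp [DarbouxData.e_apply]) (by simp [DarbouxData.e_apply])
  · exact X.n₂_ne_smul hν 1 t c

/-! The total family. -/

/-- The box-coordinate family starts at the box coordinates of `ν`. [folklore] -/
theorem mf_zero (t : ℝ) : X.mf ν 0 t = X.nbox ν t := by
  simp [mf, n₁_zero]

/-- During the second half the box coordinates are those at the end of phase 0b. [folklore] -/
theorem mf_of_half_le {r : ℝ} (hr : 1 / 2 ≤ r) (t : ℝ) : X.mf ν r t = X.n₃ ν 1 t := by
  have h1 : ¬ r ≤ 1 / 6 := by linarith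
  have h2 : ¬ r ≤ 2 / 6 := by linarith
  rw [mf, if_neg h1, if_neg h2, n₃, n₃, cl_of_one_le (show (1 : ℝ) ≤ 6 * r - 2 by linarith), cl_one]

/-- The box-coordinate family does not move `|t| ≥ 12ε`. [folklore] -/
theorem mf_of_ge {t : ℝ} (ht : 12 * X.ε ≤ |t|) (r : ℝ) : X.mf ν r t = X.nbox ν t := by
  have hε := X.ε_pos
  have h8 : 8 * X.ε < |t| := by linarith
  have h4 : 4 * X.ε < |t| := by linarith
  unfold mf
  split_ifs
  · exact X.n₁_of_ge ht _
  · rw [X.n₂_of_lt h8, X.n₁_of_ge ht]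
  · rw [X.n₃_of_lt h4, X.n₂_of_lt h8, X.n₁_of_ge ht]

/-- During the second half the box coordinates on the core are the model framing. [folklore] -/
theorem mf_eq_fr {r t : ℝ} (hr : 1 / 2 ≤ r) (ht : |t| ≤ 4 * X.ε) :
    X.mf ν r t = LegendrianModel.fr (t / X.ε) := by
  rw [X.mf_of_half_le hr, X.n₃_of_le le_rfl ht]

/-- The box-coordinate family is jointly continuous. [folklore] -/
theorem continuous_mf (hν : IsKnotFraming X.K ν) : Continuous fun q : ℝ × ℝ => X.mf ν q.1 q.2 := by
  refine Continuous.if_le ?_ ?_ continuous_fst continuous_const ?_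
  · exact (X.continuous_n₁ hν).comp ((continuous_const.mul continuous_fst).prodMk continuous_snd)
  · refine Continuous.if_le ?_ ?_ continuous_fst continuous_const ?_
    · exact (X.continuous_n₂ hν).comp (((continuous_const.mul continuous_fst).sub continuous_const).prodMk
        continuous_snd)
    · exact (X.continuous_n₃ hν).comp (((continuous_const.mul continuous_fst).sub continuous_const).prodMk
        continuous_snd)
    · rintro ⟨r, t⟩ (h : r = 2 / 6)
      subst h
      have e1 : (6 : ℝ) * (2 / 6) - 1 = 1 := by norm_num
      have e2 : (6 : ℝ) * (2 / 6) - 2 = 0 := by norm_num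
      simp only [e1, e2, n₃_zero]
  · rintro ⟨r, t⟩ (h : r = 1 / 6)
    subst h
    have e1 : (6 : ℝ) * (1 / 6) = 1 := by norm_num
    have e2 : (6 : ℝ) * (1 / 6) - 1 = 0 := by norm_num
    have e3 : ((1 : ℝ) / 6 ≤ 2 / 6) := by norm_num
    simp only [e1, e3, if_true, sub_self, X.n₂_zero hν]

/-- The box-coordinate family stays transverse to the axis. [folklore] -/
theorem mf_ne_smul (hν : IsKnotFraming X.K ν) (r t c : ℝ) : X.mf ν r t ≠ c • DarbouxData.e 0 := by
  unfold mf; split_ifs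
  · exact X.n₁_ne_smul hν _ t c
  · exact X.n₂_ne_smul hν _ t c
  · exact X.n₃_ne_smul hν _ t c

end Phases


/-! ### The framing family along the isotopy -/

section FramingFamily

variable (ν : 𝕊 1 → E4)

/-- **The framing family read on `ℝ`**: on the window the box frame at the stage point with the
box coordinates `mf`, the given framing elsewhere. [folklore] -/
def FF (r s : ℝ) : E4 :=
  if |sdist X.s₀ s| < X.w₀ then X.bv (X.mcurve (2 * r - 1, s)) (X.mf ν r (sdist X.s₀ s))
  else ν (circlePt s)

/-- **The framing family on the circle.** [folklore] -/
def νfam (r : ℝ) (u : 𝕊 1) : E4 := X.FF ν r (angA u)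

/-- The total section `(r, s) ↦ (stage point, framing vector)` over `ℝ × ℝ`. [folklore] -/
def Φtot (q : ℝ × ℝ) : TangentBundle (𝓡∂ 4) W :=
  Bundle.TotalSpace.mk' E4 (X.G (2 * q.1 - 1) q.2) (X.FF ν q.1 q.2)

variable {ν}

/-- The model point is `1`-periodic in the knot parameter. [folklore] -/
theorem mcurve_add_int (τ s : ℝ) (m : ℤ) : X.mcurve (τ, s + m) = X.mcurve (τ, s) := by
  simp only [mcurve, sdist_add_int]

/-- The framing family on `ℝ` is `1`-periodic. [folklore] -/
theorem FF_add_int (r s : ℝ) (m : ℤ) : X.FF ν r (s + m) = X.FF ν r s := by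
  simp only [FF, sdist_add_int, circlePt_add_int, mcurve_add_int]

/-- The framing family on `ℝ` read through `angA ∘ circlePt`. [folklore] -/
theorem FF_angA_circlePt (r t : ℝ) : X.FF ν r (angA (circlePt t)) = X.FF ν r t := by
  obtain ⟨m, hm⟩ : ∃ m : ℤ, angA (circlePt t) = t + m := by
    have h : circlePt (angA (circlePt t)) = circlePt t := circlePt_angA _
    rwa [circlePt_eq_circlePt_iff] at h
  rw [hm, FF_add_int]

/-- The framing family at `circlePt t` is the family on `ℝ` at `t`. [folklore] -/
theorem νfam_circlePt (r t : ℝ) : X.νfam ν r (circlePt t) = X.FF ν r t := X.FF_angA_circlePt r t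

/-- The support of the phases lies inside the window. [folklore] -/
theorem twelve_ε_lt_w₀ : 12 * X.ε < X.w₀ := by linarith [X.ε_pos, X.ε_le_w₀]

/-- Off `|t| ≤ 12ε` the framing family is the given framing. [folklore] -/
theorem FF_eq_of_lt (hν : IsKnotFraming X.K ν) {s : ℝ} (hs : 12 * X.ε < |sdist X.s₀ s|) (r : ℝ) :
    X.FF ν r s = ν (circlePt s) := by
  unfold FF
  split_ifs with hw
  · have h4 : 4 * X.ε ≤ |sdist X.s₀ s| := by linarith [X.ε_pos]
    rw [X.mf_of_ge hs.le, X.nbox_eq hw.le, mcurve, LegendrianModel.scurve_eq_axisPt X.ε_pos h4, axisPt_eq,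
      X.bv_nraw hν (lt_trans hw X.w₀_lt_ℓ), circlePt_add_sdist]
  · rfl

/-- At time `0` the framing family is the given framing. [folklore] -/
theorem FF_zero (hν : IsKnotFraming X.K ν) (s : ℝ) : X.FF ν 0 s = ν (circlePt s) := by
  unfold FF
  split_ifs with hw
  · rw [X.mf_zero, X.nbox_eq hw.le, mcurve]
    have h0 : Real.smoothTransition ((2 : ℝ) * 0 - 1, s).1 = 0 :=
      Real.smoothTransition.zero_of_nonpos (by norm_num)
    rw [h0, LegendrianModel.scurve_zero_left _ X.ε_pos.ne', axisPt_eq, X.bv_nraw hν (lt_trans hw X.w₀_lt_ℓ),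
      circlePt_add_sdist]
  · rfl

/-- The framing family starts at `ν`. [folklore] -/
theorem νfam_zero (hν : IsKnotFraming X.K ν) : X.νfam ν 0 = ν :=
  funext fun u => by rw [νfam, X.FF_zero hν, circlePt_angA]

/-- Stages at non-positive parameter are `K`. [folklore] -/
theorem knot_of_nonpos {τ : ℝ} (hτ : τ ≤ 0) : X.knot τ = X.K := by
  funext z; rw [knot, X.G_of_nonpos hτ, circlePt_angA]

/-- **The stabilising isotopy, run during the second half of the time interval** (the first
half is kept for the framing homotopy). [folklore] -/
def isotopy₂ : KnotIsotopyInBoundary X.K (X.knot 1) where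
  toFun r := X.knot (2 * r - 1)
  contMDiff := by
    have h : ContMDiff (𝓘(ℝ, ℝ).prod (𝓡 1)) (𝓘(ℝ, ℝ).prod (𝓡 1)) ∞
        (fun q : ℝ × (𝕊 1) => (2 * q.1 - 1, q.2)) :=
      (((contDiff_const.mul contDiff_id).sub contDiff_const).contMDiff.comp contMDiff_fst).prodMk
        contMDiff_snd
    exact X.contMDiff_knot_uncurry.comp h
  isSmoothEmbedding r := X.isSmoothEmbedding_knot _
  map_zero := by show X.knot (2 * 0 - 1) = X.K; exact X.knot_of_nonpos (by norm_num)
  map_one := by show X.knot (2 * 1 - 1) = X.knot 1; norm_num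
  isBoundaryPoint r _ z := X.isBoundaryPoint_knot _ z

/-- Stages of the time-doubled isotopy. [folklore] -/
@[simp] theorem isotopy₂_toFun (r : ℝ) : X.isotopy₂.toFun r = X.knot (2 * r - 1) := rfl

/-- **The total section is continuous** (window: the box frame, `continuousAt_boxFrame`; far:
the given framing). [folklore] -/
theorem continuous_Φtot (hν : IsKnotFraming X.K ν) : Continuous (X.Φtot ν) := by
  rw [continuous_iff_continuousAt]
  rintro ⟨r, s⟩
  by_cases hw : |sdist X.s₀ s| < X.w₀
  · -- window
    have hs : s ∈ X.winSet := hw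
    have hopen : ∀ᶠ q : ℝ × ℝ in 𝓝 (r, s), q.2 ∈ X.winSet :=
      continuousAt_snd.preimage_mem_nhds (X.isOpen_winSet.mem_nhds hs)
    have hne := X.sdist_ne_half_of_mem_winSet hs
    have key : ContinuousAt (fun q : ℝ × ℝ => (Bundle.TotalSpace.mk' E4
        (X.bpt (X.mcurve (2 * q.1 - 1, q.2)))
        (X.bv (X.mcurve (2 * q.1 - 1, q.2)) (X.mf ν q.1 (sdist X.s₀ q.2))) :
          TangentBundle (𝓡∂ 4) W)) (r, s) := by
      refine X.continuousAt_boxFrame ?_ ?_ ?_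
      · have h1 : ContinuousAt X.mcurve (2 * r - 1, s) := (X.contDiffAt_mcurve hne).continuousAt
        have h2 : Continuous fun q : ℝ × ℝ => (2 * q.1 - 1, q.2) :=
          ((continuous_const.mul continuous_fst).sub continuous_const).prodMk continuous_snd
        exact ContinuousAt.comp_of_eq (g := X.mcurve) (f := fun q : ℝ × ℝ => (2 * q.1 - 1, q.2)) h1
          h2.continuousAt rfl
      · have h0 : ContinuousAt (sdist X.s₀) s := (contDiffAt_sdist hne).continuousAt
        have h1 : ContinuousAt (fun q : ℝ × ℝ => (q.1, sdist X.s₀ q.2)) (r, s) :=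
          continuousAt_fst.prodMk (ContinuousAt.comp_of_eq (g := sdist X.s₀) (f := fun q : ℝ × ℝ => q.2) h0
            continuousAt_snd rfl)
        exact ContinuousAt.comp_of_eq (g := fun q : ℝ × ℝ => X.mf ν q.1 q.2)
          (f := fun q : ℝ × ℝ => (q.1, sdist X.s₀ q.2)) (X.continuous_mf hν).continuousAt h1 rfl
      · exact X.box_subset_V (X.mcurve_mem_box (q := (2 * r - 1, s)) hw)
    refine key.congr ?_
    filter_upwards [hopen] with q hq
    show _ = X.Φtot ν q
    rw [Φtot, FF, if_pos (show |sdist X.s₀ q.2| < X.w₀ from hq), X.G_eq_of_mem_winSet hq]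
    rfl
  · -- far
    have hfar : 12 * X.ε < |sdist X.s₀ s| := lt_of_lt_of_le X.twelve_ε_lt_w₀ (not_lt.1 hw)
    have hmem : s ∈ X.farSetR (12 * X.ε) :=
      X.mem_farSetR_of_lt hfar
    have hopen : ∀ᶠ q : ℝ × ℝ in 𝓝 (r, s), q.2 ∈ X.farSetR (12 * X.ε) :=
      continuousAt_snd.preimage_mem_nhds ((X.isOpen_farSetR _).mem_nhds hmem)
    have key : ContinuousAt (fun q : ℝ × ℝ => (Bundle.TotalSpace.mk' E4 (X.K (circlePt q.2))
        (ν (circlePt q.2)) : TangentBundle (𝓡∂ 4) W)) (r, s) :=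
      (hν.continuous.comp (continuous_circlePt.comp continuous_snd)).continuousAt
    refine key.congr ?_
    filter_upwards [hopen] with q hq
    have hq' := X.lt_abs_sdist_of_mem_farSetR hq
    show _ = X.Φtot ν q
    rw [Φtot, X.FF_eq_of_lt hν hq', X.G_eq_K_of_mem (by linarith [X.ε_pos])]

/-- The total section is `1`-periodic. [folklore] -/
theorem Φtot_add_int (r s : ℝ) (m : ℤ) : X.Φtot ν (r, s + m) = X.Φtot ν (r, s) := by
  simp only [Φtot]
  rw [X.FF_add_int, X.G_add_int]

/-- **Joint continuity of `(r, u) ↦ (stage point, framing vector)` on `ℝ × S¹`.** [folklore] -/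
theorem continuous_total (hν : IsKnotFraming X.K ν) : Continuous fun q : ℝ × (𝕊 1) =>
    (Bundle.TotalSpace.mk' E4 (X.knot (2 * q.1 - 1) q.2) (X.νfam ν q.1 q.2) : TangentBundle (𝓡∂ 4) W) := by
  rw [continuous_iff_continuousAt]
  rintro ⟨r, u⟩
  by_cases hA : u = ptA
  · subst hA
    have heq : (fun q : ℝ × (𝕊 1) => X.Φtot ν (q.1, angB q.2)) = fun q =>
        (Bundle.TotalSpace.mk' E4 (X.knot (2 * q.1 - 1) q.2) (X.νfam ν q.1 q.2) :
          TangentBundle (𝓡∂ 4) W) := by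
      funext q
      obtain ⟨m, hm⟩ := exists_int_angB_eq q.2
      show X.Φtot ν (q.1, angB q.2) = X.Φtot ν (q.1, angA q.2)
      rw [hm, Φtot_add_int]
    rw [← heq]
    have hB : ContinuousAt angB ptA := (contMDiffAt_angB ptA_ne_ptB).continuousAt
    have h1 : ContinuousAt (fun q : ℝ × (𝕊 1) => (q.1, angB q.2)) (r, ptA) :=
      continuousAt_fst.prodMk (ContinuousAt.comp_of_eq (g := angB) (f := fun q : ℝ × (𝕊 1) => q.2) hB
        continuousAt_snd rfl)
    exact ContinuousAt.comp_of_eq (g := X.Φtot ν) (f := fun q : ℝ × (𝕊 1) => (q.1, angB q.2))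
      (X.continuous_Φtot hν).continuousAt h1 rfl
  · show ContinuousAt (fun q : ℝ × (𝕊 1) => X.Φtot ν (q.1, angA q.2)) (r, u)
    have hA' : ContinuousAt angA u := (contMDiffAt_angA hA).continuousAt
    have h1 : ContinuousAt (fun q : ℝ × (𝕊 1) => (q.1, angA q.2)) (r, u) :=
      continuousAt_fst.prodMk (ContinuousAt.comp_of_eq (g := angA) (f := fun q : ℝ × (𝕊 1) => q.2) hA'
        continuousAt_snd rfl)
    exact ContinuousAt.comp_of_eq (g := X.Φtot ν) (f := fun q : ℝ × (𝕊 1) => (q.1, angA q.2))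
      (X.continuous_Φtot hν).continuousAt h1 rfl

/-- **Every stage of the framing family is a framing of the corresponding stage of the
isotopy.** [folklore] -/
theorem isKnotFraming_νfam (hν : IsKnotFraming X.K ν) (r : ℝ) :
    IsKnotFraming (X.knot (2 * r - 1)) (X.νfam ν r) where
  continuous := by
    have h := (X.continuous_total hν).comp (Continuous.prodMk_right r)
    exact h
  mem_boundaryTangentSpace u := by
    show X.FF ν r (angA u) 0 = 0
    unfold FF
    split_ifs with hw
    · exact X.bv_apply_zero (X.box_subset_V (X.mcurve_mem_box (q := (2 * r - 1, angA u)) hw)) _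
    · exact hν.mem_boundaryTangentSpace _
  not_mem_span t := by
    rw [X.νfam_circlePt]
    unfold FF
    split_ifs with hw
    · have hs : t ∈ X.winSet := hw
      have hV := X.box_subset_V (X.mcurve_mem_box (q := (2 * r - 1, t)) hw)
      rw [X.knotVelocity_knot_window hs]
      apply X.bv_not_mem_span hV
      intro c
      by_cases h4 : 4 * X.ε ≤ |sdist X.s₀ t|
      · rw [dscurve_eq_e0 X.ε_pos h4]; exact X.mf_ne_smul hν r _ c
      · by_cases hr2 : r ≤ 1 / 2
        · rw [Real.smoothTransition.zero_of_nonpos (by linarith), dscurve_zero_left]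
          exact X.mf_ne_smul hν r _ c
        · rw [X.mf_eq_fr (by linarith) (not_le.1 h4).le]
          exact LegendrianModel.fr_ne_smul_dscurve X.ε_pos (smoothTransition_mem _) _ c
    · rw [X.knotVelocity_knot_far (X.mem_farSet_of_le (not_lt.1 hw))]
      exact hν.not_mem_span t

/-- **The framing `ν` is carried along the stabilising isotopy by the family `νfam`.**
[folklore] -/
theorem isFramingAlong_νfam (hν : IsKnotFraming X.K ν) : IsFramingAlong X.isotopy₂ ν (X.νfam ν) where
  apply_zero := X.νfam_zero hν
  isKnotFraming r _ := X.isKnotFraming_νfam hν r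
  continuousOn := (X.continuous_total hν).continuousOn

end FramingFamily

end StabData

end LegendrianDarboux

end Literature.Geometry.Symplectic

end
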